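import Literature.NumberTheory.LFunctions.VinogradovKorobovZeroDetector
import Literature.NumberTheory.LFunctions.ApproxFunctionalEquation
import Literature.Analysis.SpecialFunctions.SechSqFourier
import Literature.Analysis.SpecialFunctions.GammaProductBounds
import Mathlib.Analysis.SpecialFunctions.ImproperIntegrals
import Mathlib.MeasureTheory.Integral.Gamma
import Mathlib.Analysis.Calculus.Deriv.MeanValue
import HarnessLib

/-!
# Ford's bound for `∫ log|ζ(σ + it + iau)|/cosh²u du` (Ford 2002, Lemma 3.4 = Mossinghoff–Trudgian–Yang, Lemma 4.3)

Topic `Literature/NumberTheory/LFunctions`. Part of the decomposition of the explicit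
Vinogradov–Korobov zero-free region of Mossinghoff–Trudgian–Yang (*Res. Number Theory* 10 (2024)
= arXiv:2212.06867; architecture in `VinogradovKorobov.lean`). Everything here is PROVED; no
definition and no named fact is introduced.

**Lemma 3.4 of Ford** (*Zero-free regions for the Riemann zeta function* (2002); copied as
Lemma 4.3 of Mossinghoff–Trudgian–Yang): fix `σ ∈ [1/2, 1)` and suppose that for all `t ≥ 3`,
`|ζ(σ + iy)| ≤ X t^Y (log t)^Z` for `1 ≤ |y| ≤ t`, with positive constants `X, Y, Z`,
`Y + Z ≥ 0.1`. If `0 < a ≤ 1/2`, `t ≥ 100` and `1/2 ≤ σ ≤ 1 − 1/t`, then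
`∫_{-∞}^{∞} log|ζ(σ + it + iau)|/cosh²u du ≤ 2(log X + Y log t + Z log log t)`
(`integral_log_norm_zeta_div_cosh_sq_le`; in the notation of `VinogradovKorobovZeroDetector.lean`,
`fordLogZetaIntegral σ t a ≤ 2(…)`, `fordLogZetaIntegral_le_of_zeta_bound`). This is the lemma
through which the upper bounds for `ζ` (Richert/Ford (3.1) on `Re s = 1 − η`, Patel's (3.3) on
`Re s = 1/2`) enter the zero detector (Ford Lemma 4.1, 4.6; MTY Lemmas 4.2, 4.7, 6.1).

## Proof (Ford's, with cruder intermediate constants)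

Pointwise in `u`, with `y = t + au`, `ℓ = log t`, `M₀ = log X + Yℓ + Z log ℓ`, `c = Y + Z/ℓ`:
for `1 ≤ |y| ≤ t` the hypothesis at `t` gives `log|ζ| ≤ M₀`; for `y ≥ 3` the hypothesis at `y`
and `log(1 + x) ≤ x − x²/2 + x³/3` (`x = au/t > −1`) give `log|ζ| ≤ M₀ + c(x − x²/2 + x³/3)`; for
`y ≤ −t` the hypothesis at `|y|` and `log(1 + v) ≤ v` give `log|ζ| ≤ M₀ + c(−x − 2)`; for `|y| < 1`,
Titchmarsh (2.1.4) (here (4.11.2) at `N = 1`, `AFE.norm_zeta_sub_sum_add_le`) and `|s − 1| ≥ 1/t`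
give `log|ζ(s)| ≤ log(t + 4)`. Integrating the resulting majorant against `1/cosh²u`
(`∫ du/cosh²u = 2`, `∫ u/cosh²u = ∫ u³/cosh²u = 0`, `∫ u²/cosh²u ≥ 1/2`, `1/cosh²u ≤ 4e^{−2|u|}`)
leaves `2M₀ − c a²/(4t²)` plus three exponentially small terms, which the negative term absorbs
(`Y + Z/ℓ ≥ 0.1/ℓ`). If `log|ζ|/cosh²` is not integrable along the line (zeros of `ζ` on it), the
Lean integral is `0 ≤ 2M₀`.

## Faithfulness notes

1. The hypothesis `1 ≤ X` is added explicitly. The printed proof integrates the main term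
   `log(X t^Y log^Z t)` over ALL `u` ("Combining these estimates together with
   `∫ (cosh u)^{−2} du = 2`"), which is an upper bound only when `log(X t^Y log^Z t) ≥ 0`; this is
   implicit in the source and holds in every application (Ford/MTY: `X = A > 1` from (3.1);
   MTY §6: `X = 307.098` from Patel's bound).
2. The source's second-moment constant `π²/12` is replaced by the cruder `1/4`
   (`∫ u²/cosh²u ≥ ∫ u²e^{−2|u|} = 1/2`), and the three small terms are bounded crudely; the
   statement proved is exactly the printed one.
3. `log|ζ|` is Lean's `Real.log ‖ζ‖` (value `0` at a zero) and the integral is the Bochner integral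
   (value `0` if the integrand is not integrable); both conventions only help the inequality.

## References

* K. Ford, *Zero-free regions for the Riemann zeta function*, Number Theory for the Millennium II
  (2002), 25–56 = arXiv:1910.08205, Lemma 3.4 and its proof. (`Ford2002Millennium`)
* M. J. Mossinghoff, T. S. Trudgian, A. Yang, Res. Number Theory 10 (2024) = arXiv:2212.06867,
  Lemma 4.3. (`MossinghoffTrudgianYangRNT2024`)
* E. C. Titchmarsh, *The Theory of the Riemann Zeta-Function*, (2.1.4)/(4.11.2) (via
  `ApproxFunctionalEquation.lean`).

## Addendum (2026-08-15): lines closer to the pole than `1/t`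

Ford's hypothesis `σ ≤ 1 − 1/t` serves only to bound `log|ζ(σ + iy)|` on the window `|y| < 1`
(by `log(t + 4)`). For Ford's Lemma 4.1 / MTY Lemma 4.2 with *every* `η ∈ (0, 1/2]` the line
`Re s = 1 − η` may have `η < 1/t`; there `log|ζ| ≤ log(1/η + 4)` on the window and the same proof
goes through with room to spare. We therefore also provide
`integral_log_norm_zeta_div_cosh_sq_le_of_near` (the near-axis bound `L` as a parameter),
`integral_log_norm_zeta_div_cosh_sq_le'` and `fordLogZetaIntegral_le_of_zeta_bound'`
(`1/2 ≤ σ < 1`, `1 − σ ≥ e^{−t/a}`; `FordL34.log_norm_zeta_le_near_of_lt_one`,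
`FordL34.integral_near_le_of_const`, `FordL34.numerics_near'`). The printed statements are
unchanged and are now corollaries of the parametrised one.
-/

noncomputable section

open Complex Real MeasureTheory Set Filter
open scoped Topology

namespace Literature.NumberTheory.LFunctions

namespace FordL34

open Literature.Analysis.SpecialFunctions

/-! ## Toolkit: `1/cosh²`, `xⁿe^{−x}`, odd integrals, moments -/

/-- `1/cosh²u ≤ 4e^{−2|u|}` (`e^{|u|} ≤ 2cosh u`). [cite: Ford2002Millennium, proof of Lemma 3.4] -/
theorem one_div_cosh_sq_le (u : ℝ) : 1 / Real.cosh u ^ 2 ≤ 4 * Real.exp (-(2 * |u|)) := by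
  have h : Real.exp |u| ≤ 2 * Real.cosh u := by
    rw [Real.cosh_eq]
    have h1 := Real.exp_pos u
    have h2 := Real.exp_pos (-u)
    rcases le_or_gt 0 u with h | h
    · rw [abs_of_nonneg h]; linarith
    · rw [abs_of_neg h]; linarith
  have he : 0 < Real.exp |u| := Real.exp_pos _
  have hc : 0 < Real.cosh u := Real.cosh_pos u
  have key : Real.exp (2 * |u|) ≤ 4 * Real.cosh u ^ 2 := by
    rw [two_mul, Real.exp_add]; nlinarith [h, he]
  have hE : 0 < Real.exp (2 * |u|) := Real.exp_pos _
  rw [Real.exp_neg, div_le_iff₀ (pow_pos hc 2),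
    show 4 * (Real.exp (2 * |u|))⁻¹ * Real.cosh u ^ 2 = (4 * Real.cosh u ^ 2) / Real.exp (2 * |u|) by ring,
    le_div_iff₀ hE]
  linarith

/-- `e^{−2|u|} ≤ 1/cosh²u` (`cosh u ≤ e^{|u|}`). [cite: Ford2002Millennium, proof of Lemma 3.4] -/
theorem exp_neg_two_abs_le (u : ℝ) : Real.exp (-(2 * |u|)) ≤ 1 / Real.cosh u ^ 2 := by
  have h : Real.cosh u ≤ Real.exp |u| := by
    rw [Real.cosh_eq]
    have h1 : Real.exp u ≤ Real.exp |u| := Real.exp_le_exp.2 (le_abs_self u)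
    have h2 : Real.exp (-u) ≤ Real.exp |u| := Real.exp_le_exp.2 (neg_le_abs u)
    linarith
  have hc : 0 < Real.cosh u := Real.cosh_pos u
  have key : Real.cosh u ^ 2 ≤ Real.exp (2 * |u|) := by
    rw [two_mul, Real.exp_add]; nlinarith [h, hc]
  have hE : 0 < Real.exp (2 * |u|) := Real.exp_pos _
  rw [Real.exp_neg, le_div_iff₀ (pow_pos hc 2),
    show (Real.exp (2 * |u|))⁻¹ * Real.cosh u ^ 2 = Real.cosh u ^ 2 / Real.exp (2 * |u|) by ring,
    div_le_iff₀ hE]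
  linarith

/-- `xⁿ e^{−x} ≤ n!` for `x ≥ 0`. [folklore] -/
theorem pow_mul_exp_neg_le (n : ℕ) {x : ℝ} (hx : 0 ≤ x) :
    x ^ n * Real.exp (-x) ≤ n.factorial := by
  have h := Real.pow_div_factorial_le_exp x hx n
  have hf : (0 : ℝ) < n.factorial := by positivity
  rw [div_le_iff₀ hf] at h
  rw [Real.exp_neg, ← div_eq_mul_inv, div_le_iff₀ (Real.exp_pos x)]
  linarith

/-- The integral over `ℝ` of an odd function vanishes (no integrability needed). [folklore] -/
theorem integral_eq_zero_of_odd {f : ℝ → ℝ} (hf : ∀ u, f (-u) = -f u) : ∫ u, f u = 0 := by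
  have h := integral_neg_eq_self f volume
  simp_rw [hf, integral_neg] at h
  linarith

/-- `f/cosh²` is integrable when `f` is measurable with `|f(u)| ≤ C(1 + |u|)ᵏ`. [folklore] -/
theorem integrable_div_cosh_sq_of_le {f : ℝ → ℝ} (hf : AEStronglyMeasurable f) (k : ℕ) {C : ℝ}
    (hC : ∀ u, |f u| ≤ C * (1 + |u|) ^ k) : Integrable fun u : ℝ ↦ f u / Real.cosh u ^ 2 := by
  have hI := (integrable_one_add_abs_rpow_mul_exp_neg (a := 2) (p := k) two_pos k.cast_nonneg).const_mul
    (4 * C)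
  refine hI.mono' (hf.div₀ (g := fun u ↦ Real.cosh u ^ 2) (by fun_prop)) (ae_of_all _ fun u ↦ ?_)
  have hc : 0 < Real.cosh u ^ 2 := by positivity
  rw [Real.norm_eq_abs, abs_div, abs_of_pos hc, Real.rpow_natCast]
  calc |f u| / Real.cosh u ^ 2 = |f u| * (1 / Real.cosh u ^ 2) := by ring
    _ ≤ (C * (1 + |u|) ^ k) * (4 * Real.exp (-(2 * |u|))) :=
        mul_le_mul (hC u) (one_div_cosh_sq_le u) (by positivity)
          ((abs_nonneg _).trans (hC u))
    _ = 4 * C * ((1 + |u|) ^ k * Real.exp (-(2 * |u|))) := by ring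

/-- `uᵏ/cosh²u` is integrable. [folklore] -/
theorem integrable_pow_div_cosh_sq (k : ℕ) : Integrable fun u : ℝ ↦ u ^ k / Real.cosh u ^ 2 := by
  refine integrable_div_cosh_sq_of_le (by fun_prop) k (C := 1) fun u ↦ ?_
  rw [abs_pow, one_mul]
  exact pow_le_pow_left₀ (abs_nonneg u) (by linarith [abs_nonneg u]) k

/-- `∫ u/cosh²u du = 0`. [cite: Ford2002Millennium, proof of Lemma 3.4] -/
theorem integral_id_div_cosh_sq : ∫ u : ℝ, u / Real.cosh u ^ 2 = 0 :=
  integral_eq_zero_of_odd fun u ↦ by rw [Real.cosh_neg]; ring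

/-- `∫ u³/cosh²u du = 0`. [cite: Ford2002Millennium, proof of Lemma 3.4] -/
theorem integral_cube_div_cosh_sq : ∫ u : ℝ, u ^ 3 / Real.cosh u ^ 2 = 0 :=
  integral_eq_zero_of_odd fun u ↦ by rw [Real.cosh_neg]; ring

/-- `∫ e^{−|u|} du = 2`. [folklore] -/
theorem integral_exp_neg_abs : ∫ u : ℝ, Real.exp (-|u|) = 2 := by
  have h := integral_comp_abs (f := fun x ↦ Real.exp (-x))
  rw [h, integral_exp_neg_Ioi_zero]; norm_num

/-- `∫ e^{−|u|/2} du = 4`. [folklore] -/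
theorem integral_exp_neg_abs_half : ∫ u : ℝ, Real.exp (-(|u| / 2)) = 4 := by
  have h := integral_comp_abs (f := fun x ↦ Real.exp (-(x / 2)))
  rw [h]
  have h2 := integral_exp_mul_Ioi (a := -(1 / 2 : ℝ)) (by norm_num) 0
  have e : (fun x : ℝ ↦ Real.exp (-(x / 2))) = fun x ↦ Real.exp (-(1 / 2 : ℝ) * x) := by
    funext x; ring_nf
  rw [e, h2]; norm_num

/-- `∫ u² e^{−2|u|} du = 1/2`. [folklore] -/
theorem integral_sq_mul_exp_neg_two_abs : ∫ u : ℝ, u ^ 2 * Real.exp (-(2 * |u|)) = 1 / 2 := by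
  have h := integral_comp_abs (f := fun x ↦ x ^ 2 * Real.exp (-(2 * x)))
  simp only [sq_abs] at h
  rw [h]
  have hG := integral_rpow_mul_exp_neg_mul_rpow (p := 1) (q := 2) (b := 2) one_pos (by norm_num) two_pos
  have e : ∫ x in Ioi (0 : ℝ), x ^ (2 : ℝ) * Real.exp (-2 * x ^ (1 : ℝ)) =
      ∫ x in Ioi (0 : ℝ), x ^ 2 * Real.exp (-(2 * x)) := by
    refine setIntegral_congr_fun measurableSet_Ioi fun x _ ↦ ?_
    rw [Real.rpow_two, Real.rpow_one]; ring_nf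
  rw [← e, hG, show ((2 : ℝ) + 1) / 1 = (2 : ℕ) + 1 by norm_num, Real.Gamma_nat_eq_factorial]
  rw [show (-((2 : ℝ) + 1) / 1) = -(3 : ℝ) by norm_num, Real.rpow_neg (by norm_num),
    show (3 : ℝ) = ((3 : ℕ) : ℝ) by norm_num, Real.rpow_natCast]
  norm_num [Nat.factorial]

/-- `∫ u²/cosh²u du ≥ 1/2` (the source uses the exact value `π²/6`). [cite: Ford2002Millennium, proof of Lemma 3.4] -/
theorem half_le_integral_sq_div_cosh_sq : 1 / 2 ≤ ∫ u : ℝ, u ^ 2 / Real.cosh u ^ 2 := by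
  rw [← integral_sq_mul_exp_neg_two_abs]
  refine integral_mono ?_ (integrable_pow_div_cosh_sq 2) fun u ↦ ?_
  · have := (integrable_one_add_abs_rpow_mul_exp_neg (a := 2) (p := 2) two_pos (by norm_num))
    refine this.mono' (by fun_prop) (ae_of_all _ fun u ↦ ?_)
    rw [Real.norm_eq_abs, abs_mul, abs_of_pos (Real.exp_pos _), abs_pow, Real.rpow_two]
    exact mul_le_mul_of_nonneg_right
      (pow_le_pow_left₀ (abs_nonneg u) (by linarith [abs_nonneg u]) 2) (Real.exp_pos _).le
  · dsimp only
    rw [div_eq_mul_one_div]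
    exact mul_le_mul_of_nonneg_left (exp_neg_two_abs_le u) (sq_nonneg u)

/-! ## `log(1 + x) ≤ x − x²/2 + x³/3` and logarithms of norms -/

/-- `log(1 + x) ≤ x − x²/2 + x³/3` for `x > −1`. [cite: Ford2002Millennium, proof of Lemma 3.4] -/
theorem log_one_add_le_cubic {x : ℝ} (hx : -1 < x) :
    Real.log (1 + x) ≤ x - x ^ 2 / 2 + x ^ 3 / 3 := by
  -- `φ(y) = y − y²/2 + y³/3 − log(1+y)`, `φ' = y³/(1+y)`, `φ(0) = 0`
  set φ : ℝ → ℝ := fun y ↦ y - y * y / 2 + y * y * y / 3 - Real.log (1 + y) with hφ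
  have hderiv : ∀ y : ℝ, -1 < y → HasDerivAt φ (y ^ 3 / (1 + y)) y := by
    intro y hy
    have h1 : HasDerivAt (fun y : ℝ ↦ y - y * y / 2 + y * y * y / 3) (1 - y + y ^ 2) y := by
      have hi := hasDerivAt_id' y
      have h := (hi.sub ((hi.mul hi).div_const 2)).add (((hi.mul hi).mul hi).div_const 3)
      refine h.congr_deriv ?_
      simp only [Pi.mul_apply]
      ring
    have h2 : HasDerivAt (fun y : ℝ ↦ Real.log (1 + y)) (1 / (1 + y)) y := by
      have := ((hasDerivAt_id y).const_add 1).log (ne_of_gt (by simp only [id]; linarith))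
      simpa using this
    have h3 := h1.sub h2
    have hy1 : (1 + y) ≠ 0 := (ne_of_gt (by linarith))
    have e : 1 - y + y ^ 2 - 1 / (1 + y) = y ^ 3 / (1 + y) := by field_simp; ring
    rw [e] at h3
    exact h3
  have hcont : ContinuousOn φ (Ioi (-1)) := fun y hy ↦
    (hderiv y hy).continuousAt.continuousWithinAt
  have hφ0 : φ 0 = 0 := by simp [hφ]
  suffices h : 0 ≤ φ x by
    have h' : φ x = x - x * x / 2 + x * x * x / 3 - Real.log (1 + x) := rfl
    rw [h'] at h
    have e1 : x * x = x ^ 2 := by ring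
    have e2 : x * x * x = x ^ 3 := by ring
    rw [e2, e1] at h
    linarith
  rcases le_or_gt 0 x with h0 | h0
  · -- monotone on `[0, ∞)`
    have hmono : MonotoneOn φ (Ici 0) := by
      refine monotoneOn_of_deriv_nonneg (convex_Ici 0) (hcont.mono fun y hy ↦ ?_) ?_ ?_
      · exact lt_of_lt_of_le (by norm_num) (mem_Ici.1 hy)
      · intro y hy
        rw [interior_Ici] at hy
        exact (hderiv y (by linarith [mem_Ioi.1 hy])).differentiableAt.differentiableWithinAt
      · intro y hy
        rw [interior_Ici] at hy
        have hy' : 0 < y := hy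
        rw [(hderiv y (by linarith)).deriv]
        positivity
    rw [← hφ0]
    exact hmono (mem_Ici.2 le_rfl) (mem_Ici.2 h0) h0
  · -- antitone on `(-1, 0]`
    have hanti : AntitoneOn φ (Ioc (-1) 0) := by
      refine antitoneOn_of_deriv_nonpos (convex_Ioc _ _) (hcont.mono Ioc_subset_Ioi_self) ?_ ?_
      · intro y hy
        rw [interior_Ioc] at hy
        exact (hderiv y hy.1).differentiableAt.differentiableWithinAt
      · intro y hy
        rw [interior_Ioc] at hy
        rw [(hderiv y hy.1).deriv]
        have h1 : 0 < 1 + y := by linarith [hy.1]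
        have h3 : y ^ 3 ≤ 0 := by
          have : y ^ 3 = -((-y) ^ 3) := by ring
          rw [this, neg_nonpos]
          exact pow_nonneg (by linarith [hy.2]) 3
        exact div_nonpos_of_nonpos_of_nonneg h3 h1.le
    rw [← hφ0]
    exact hanti ⟨hx, h0.le⟩ ⟨by norm_num, le_rfl⟩ h0.le

/-- `log ‖z‖ ≤ log Q` whenever `‖z‖ ≤ Q` and `Q ≥ 1` (also when `z = 0`, where Lean's `log 0 = 0`).
[folklore] -/
theorem log_norm_le_log {z : ℂ} {Q : ℝ} (hQ : 1 ≤ Q) (h : ‖z‖ ≤ Q) :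
    Real.log ‖z‖ ≤ Real.log Q := by
  rcases eq_or_lt_of_le (norm_nonneg z) with h0 | h0
  · rw [← h0, Real.log_zero]; exact Real.log_nonneg hQ
  · exact Real.log_le_log h0 h

/-- `log(X T^Y (log T)^Z) = log X + Y log T + Z log log T` for `X > 0`, `T > 1`. [folklore] -/
theorem log_bound_eq {X Y Z T : ℝ} (hX : 0 < X) (hT : 1 < T) :
    Real.log (X * T ^ Y * Real.log T ^ Z) = Real.log X + Y * Real.log T + Z * Real.log (Real.log T) := by
  have hT0 : 0 < T := by linarith
  have hl : 0 < Real.log T := Real.log_pos hT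
  rw [Real.log_mul (mul_pos hX (Real.rpow_pos_of_pos hT0 _)).ne' (Real.rpow_pos_of_pos hl _).ne',
    Real.log_mul hX.ne' (Real.rpow_pos_of_pos hT0 _).ne', Real.log_rpow hT0, Real.log_rpow hl]

/-- `1 ≤ X T^Y (log T)^Z` for `X ≥ 1`, `T ≥ 3`, `Y, Z ≥ 0`. [folklore] -/
theorem one_le_bound {X Y Z T : ℝ} (hX : 1 ≤ X) (hT : 3 ≤ T) (hY : 0 ≤ Y) (hZ : 0 ≤ Z) :
    1 ≤ X * T ^ Y * Real.log T ^ Z := by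
  have hl : 1 ≤ Real.log T := by
    rw [← Real.log_exp 1]
    refine Real.log_le_log (Real.exp_pos 1) ?_
    have := Real.exp_one_lt_d9
    linarith
  have h1 : 1 ≤ T ^ Y := Real.one_le_rpow (by linarith) hY
  have h2 : 1 ≤ Real.log T ^ Z := Real.one_le_rpow hl hZ
  calc (1 : ℝ) = 1 * 1 * 1 := by ring
    _ ≤ X * T ^ Y * Real.log T ^ Z := by gcongr

/-! ## Pointwise bounds for `log|ζ(σ + iy)|` -/

section pointwise

variable {σ X Y Z t : ℝ}

/-- **Main range** `1 ≤ |y| ≤ t`: `log|ζ(σ + iy)| ≤ log X + Y log t + Z log log t` (the hypothesis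
at `t`). [cite: Ford2002Millennium, proof of Lemma 3.4] -/
theorem log_norm_zeta_le_main (hX : 1 ≤ X) (hY : 0 ≤ Y) (hZ : 0 ≤ Z) (ht : 3 ≤ t)
    (hyp : ∀ T : ℝ, 3 ≤ T → ∀ y : ℝ, 1 ≤ |y| → |y| ≤ T →
      ‖riemannZeta (σ + y * I)‖ ≤ X * T ^ Y * Real.log T ^ Z)
    {y : ℝ} (hy1 : 1 ≤ |y|) (hyt : |y| ≤ t) :
    Real.log ‖riemannZeta (σ + y * I)‖ ≤ Real.log X + Y * Real.log t + Z * Real.log (Real.log t) := by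
  rw [← log_bound_eq (by linarith) (by linarith)]
  exact log_norm_le_log (one_le_bound hX ht hY hZ) (hyp t ht y hy1 hyt)

/-- **Upper range** `y ≥ 3`: with `x = y/t − 1`,
`log|ζ(σ + iy)| ≤ log X + Y log t + Z log log t + (Y + Z/log t)(x − x²/2 + x³/3)` (the hypothesis at
`y`, `log(1 + x) ≤ x − x²/2 + x³/3` twice). [cite: Ford2002Millennium, proof of Lemma 3.4] -/
theorem log_norm_zeta_le_upper (hX : 1 ≤ X) (hY : 0 ≤ Y) (hZ : 0 ≤ Z) (ht : 3 ≤ t)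
    (hyp : ∀ T : ℝ, 3 ≤ T → ∀ y : ℝ, 1 ≤ |y| → |y| ≤ T →
      ‖riemannZeta (σ + y * I)‖ ≤ X * T ^ Y * Real.log T ^ Z)
    {y : ℝ} (hy : 3 ≤ y) :
    Real.log ‖riemannZeta (σ + y * I)‖ ≤ Real.log X + Y * Real.log t + Z * Real.log (Real.log t)
      + (Y + Z / Real.log t) * ((y / t - 1) - (y / t - 1) ^ 2 / 2 + (y / t - 1) ^ 3 / 3) := by
  set x : ℝ := y / t - 1 with hx
  set g : ℝ := x - x ^ 2 / 2 + x ^ 3 / 3 with hg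
  have ht0 : 0 < t := by linarith
  have hy0 : 0 < y := by linarith
  have hℓ : 0 < Real.log t := Real.log_pos (by linarith)
  have hly : 0 < Real.log y := Real.log_pos (by linarith)
  have hx1 : -1 < x := by
    have : 0 < y / t := div_pos hy0 ht0
    simp only [hx]; linarith
  -- the hypothesis at `T = y`
  have h1 : Real.log ‖riemannZeta (σ + y * I)‖ ≤ Real.log X + Y * Real.log y + Z * Real.log (Real.log y) := by
    rw [← log_bound_eq (by linarith) (by linarith)]
    refine log_norm_le_log (one_le_bound hX hy hY hZ) (hyp y hy y ?_ ?_)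
    · rw [abs_of_pos hy0]; linarith
    · rw [abs_of_pos hy0]
  -- `log y = log t + log(1 + x) ≤ log t + g`
  have hlogy : Real.log y = Real.log t + Real.log (1 + x) := by
    rw [show 1 + x = y / t by simp only [hx]; ring, Real.log_div hy0.ne' ht0.ne']; ring
  have hd : Real.log (1 + x) ≤ g := log_one_add_le_cubic hx1
  have h2 : Real.log y ≤ Real.log t + g := by rw [hlogy]; linarith
  -- `log log y ≤ log log t + g/log t`
  have h3 : Real.log (Real.log y) ≤ Real.log (Real.log t) + g / Real.log t := by
    have hq : 0 < Real.log y / Real.log t := div_pos hly hℓ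
    have e1 : Real.log (Real.log y) = Real.log (Real.log t) + Real.log (Real.log y / Real.log t) := by
      rw [Real.log_div hly.ne' hℓ.ne']; ring
    have e2 : Real.log (Real.log y / Real.log t) ≤ Real.log y / Real.log t - 1 :=
      Real.log_le_sub_one_of_pos hq
    have e3 : Real.log y / Real.log t - 1 = Real.log (1 + x) / Real.log t := by
      rw [hlogy]; field_simp; ring
    have e4 : Real.log (1 + x) / Real.log t ≤ g / Real.log t :=
      div_le_div_of_nonneg_right hd hℓ.le
    linarith
  have h4 : Y * Real.log y ≤ Y * (Real.log t + g) := mul_le_mul_of_nonneg_left h2 hY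
  have h5 : Z * Real.log (Real.log y) ≤ Z * (Real.log (Real.log t) + g / Real.log t) :=
    mul_le_mul_of_nonneg_left h3 hZ
  have e : Real.log X + Y * (Real.log t + g) + Z * (Real.log (Real.log t) + g / Real.log t)
      = Real.log X + Y * Real.log t + Z * Real.log (Real.log t) + (Y + Z / Real.log t) * g := by
    field_simp
    ring
  linarith

/-- **Lower range** `y ≤ −t`: `log|ζ(σ + iy)| ≤ log X + Y log t + Z log log t + (Y + Z/log t)(−y/t − 1)`
(the hypothesis at `|y|`, `log(1 + v) ≤ v`). [cite: Ford2002Millennium, proof of Lemma 3.4] -/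
theorem log_norm_zeta_le_lower (hX : 1 ≤ X) (hY : 0 ≤ Y) (hZ : 0 ≤ Z) (ht : 3 ≤ t)
    (hyp : ∀ T : ℝ, 3 ≤ T → ∀ y : ℝ, 1 ≤ |y| → |y| ≤ T →
      ‖riemannZeta (σ + y * I)‖ ≤ X * T ^ Y * Real.log T ^ Z)
    {y : ℝ} (hy : y ≤ -t) :
    Real.log ‖riemannZeta (σ + y * I)‖ ≤ Real.log X + Y * Real.log t + Z * Real.log (Real.log t)
      + (Y + Z / Real.log t) * (-y / t - 1) := by
  set v : ℝ := -y / t - 1 with hv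
  have ht0 : 0 < t := by linarith
  have hT : 3 ≤ -y := by linarith
  have hT0 : 0 < -y := by linarith
  have hℓ : 0 < Real.log t := Real.log_pos (by linarith)
  have hly : 0 < Real.log (-y) := Real.log_pos (by linarith)
  have hv0 : 0 ≤ v := by
    simp only [hv]; rw [le_sub_iff_add_le, zero_add, le_div_iff₀ ht0]; linarith
  have h1 : Real.log ‖riemannZeta (σ + y * I)‖ ≤
      Real.log X + Y * Real.log (-y) + Z * Real.log (Real.log (-y)) := by
    rw [← log_bound_eq (by linarith) (by linarith)]
    refine log_norm_le_log (one_le_bound hX hT hY hZ) (hyp (-y) hT y ?_ ?_)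
    · rw [abs_of_neg (by linarith)]; linarith
    · rw [abs_of_neg (by linarith)]
  have hlogy : Real.log (-y) = Real.log t + Real.log (1 + v) := by
    rw [show 1 + v = -y / t by simp only [hv]; ring, Real.log_div hT0.ne' ht0.ne']; ring
  have hd : Real.log (1 + v) ≤ v := by
    have := Real.log_le_sub_one_of_pos (by linarith : 0 < 1 + v); linarith
  have h2 : Real.log (-y) ≤ Real.log t + v := by rw [hlogy]; linarith
  have h3 : Real.log (Real.log (-y)) ≤ Real.log (Real.log t) + v / Real.log t := by
    have hq : 0 < Real.log (-y) / Real.log t := div_pos hly hℓ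
    have e1 : Real.log (Real.log (-y)) = Real.log (Real.log t) + Real.log (Real.log (-y) / Real.log t) := by
      rw [Real.log_div hly.ne' hℓ.ne']; ring
    have e2 : Real.log (Real.log (-y) / Real.log t) ≤ Real.log (-y) / Real.log t - 1 :=
      Real.log_le_sub_one_of_pos hq
    have e3 : Real.log (-y) / Real.log t - 1 = Real.log (1 + v) / Real.log t := by
      rw [hlogy]; field_simp; ring
    have e4 : Real.log (1 + v) / Real.log t ≤ v / Real.log t := div_le_div_of_nonneg_right hd hℓ.le
    linarith
  have h4 : Y * Real.log (-y) ≤ Y * (Real.log t + v) := mul_le_mul_of_nonneg_left h2 hY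
  have h5 : Z * Real.log (Real.log (-y)) ≤ Z * (Real.log (Real.log t) + v / Real.log t) :=
    mul_le_mul_of_nonneg_left h3 hZ
  have e : Real.log X + Y * (Real.log t + v) + Z * (Real.log (Real.log t) + v / Real.log t)
      = Real.log X + Y * Real.log t + Z * Real.log (Real.log t) + (Y + Z / Real.log t) * v := by
    field_simp
    ring
  linarith

/-- **Near the real axis** `|y| < 1`: `log|ζ(σ + iy)| ≤ log(t + 4)` for `1/2 ≤ σ ≤ 1 − 1/t`, `t ≥ 3`
(Titchmarsh (2.1.4): `|ζ(s)| ≤ 3/2 + 1/|s − 1| + |s|/(2σ)`, and `|s − 1| ≥ 1 − σ ≥ 1/t`).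
[cite: Ford2002Millennium, proof of Lemma 3.4] -/
theorem log_norm_zeta_le_near (hσ : 1 / 2 ≤ σ) (ht : 3 ≤ t) (hσt : σ ≤ 1 - 1 / t)
    {y : ℝ} (hy : |y| < 1) :
    Real.log ‖riemannZeta (σ + y * I)‖ ≤ Real.log (t + 4) := by
  have ht0 : 0 < t := by linarith
  set s : ℂ := σ + y * I with hs
  have hsre : s.re = σ := by simp [hs]
  have hsim : s.im = y := by simp [hs]
  have hσ1 : σ < 1 := by
    have : 0 < 1 / t := by positivity
    linarith
  have hs1 : s ≠ 1 := by
    intro h; have := congrArg Complex.re h; rw [hsre, Complex.one_re] at this; linarith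
  have hAFE := AFE.norm_zeta_sub_sum_add_le (s := s) (by rw [hsre]; linarith) hs1 (N := 1) le_rfl
  simp only [Finset.Icc_self, Finset.sum_singleton, Nat.cast_one, Complex.one_cpow,
    hsre] at hAFE
  rw [Real.one_rpow, one_mul] at hAFE
  -- `‖s‖ ≤ 2`, `‖1/(1 - s)‖ ≤ t`
  have hns : ‖s‖ ≤ 2 := by
    have h := Complex.norm_le_abs_re_add_abs_im s
    rw [hsre, hsim] at h
    have : |σ| ≤ 1 := by rw [abs_of_nonneg (by linarith)]; linarith
    linarith [hy.le]
  have h1s : 1 / t ≤ ‖1 - s‖ := by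
    have h := Complex.abs_re_le_norm (1 - s)
    simp only [Complex.sub_re, Complex.one_re, hsre] at h
    rw [abs_of_nonneg (by linarith)] at h
    linarith
  have hinv : ‖(1 : ℂ) / (1 - s)‖ ≤ t := by
    rw [norm_div, norm_one, div_le_iff₀ (lt_of_lt_of_le (by positivity) h1s), mul_comm,
      ← div_le_iff₀ ht0]
    rw [div_eq_mul_one_div]; simpa using h1s
  have hζ : ‖riemannZeta s‖ ≤ t + 4 := by
    have htri : ‖riemannZeta s‖ ≤ ‖riemannZeta s - 1 + 1 / (1 - s)‖ + ‖(1 : ℂ)‖ + ‖(1 : ℂ) / (1 - s)‖ := by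
      have e : riemannZeta s = (riemannZeta s - 1 + 1 / (1 - s)) + 1 - 1 / (1 - s) := by ring
      calc ‖riemannZeta s‖ = ‖(riemannZeta s - 1 + 1 / (1 - s)) + 1 - 1 / (1 - s)‖ := by rw [← e]
        _ ≤ ‖(riemannZeta s - 1 + 1 / (1 - s)) + 1‖ + ‖(1 : ℂ) / (1 - s)‖ := norm_sub_le _ _
        _ ≤ _ := by gcongr; exact norm_add_le _ _
    have hb : 1 / 2 + ‖s‖ / (2 * σ) ≤ 5 / 2 := by
      have : ‖s‖ / (2 * σ) ≤ 2 := by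
        rw [div_le_iff₀ (by linarith)]; linarith
      linarith
    rw [norm_one] at htri
    linarith
  exact log_norm_le_log (by linarith) hζ

/-- **Near the real axis, any `σ < 1`**: `log|ζ(σ + iy)| ≤ log(1/(1 − σ) + 4)` for `1/2 ≤ σ < 1`,
`|y| < 1` (same proof, with `|s − 1| ≥ 1 − σ`). [cite: Ford2002Millennium, proof of Lemma 3.4] -/
theorem log_norm_zeta_le_near_of_lt_one (hσ : 1 / 2 ≤ σ) (hσ1 : σ < 1) {y : ℝ} (hy : |y| < 1) :
    Real.log ‖riemannZeta (σ + y * I)‖ ≤ Real.log (1 / (1 - σ) + 4) := by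
  set s : ℂ := σ + y * I with hs
  have hsre : s.re = σ := by simp [hs]
  have hsim : s.im = y := by simp [hs]
  have h1σ : 0 < 1 - σ := by linarith
  have hs1 : s ≠ 1 := by
    intro h; have := congrArg Complex.re h; rw [hsre, Complex.one_re] at this; linarith
  have hAFE := AFE.norm_zeta_sub_sum_add_le (s := s) (by rw [hsre]; linarith) hs1 (N := 1) le_rfl
  simp only [Finset.Icc_self, Finset.sum_singleton, Nat.cast_one, Complex.one_cpow,
    hsre] at hAFE
  rw [Real.one_rpow, one_mul] at hAFE
  have hns : ‖s‖ ≤ 2 := by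
    have h := Complex.norm_le_abs_re_add_abs_im s
    rw [hsre, hsim] at h
    have : |σ| ≤ 1 := by rw [abs_of_nonneg (by linarith)]; linarith
    linarith [hy.le]
  have h1s : 1 - σ ≤ ‖1 - s‖ := by
    have h := Complex.abs_re_le_norm (1 - s)
    simp only [Complex.sub_re, Complex.one_re, hsre] at h
    rw [abs_of_nonneg h1σ.le] at h
    exact h
  have hinv : ‖(1 : ℂ) / (1 - s)‖ ≤ 1 / (1 - σ) := by
    rw [norm_div, norm_one]
    exact one_div_le_one_div_of_le h1σ h1s
  have hζ : ‖riemannZeta s‖ ≤ 1 / (1 - σ) + 4 := by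
    have htri : ‖riemannZeta s‖ ≤ ‖riemannZeta s - 1 + 1 / (1 - s)‖ + ‖(1 : ℂ)‖ + ‖(1 : ℂ) / (1 - s)‖ := by
      have e : riemannZeta s = (riemannZeta s - 1 + 1 / (1 - s)) + 1 - 1 / (1 - s) := by ring
      calc ‖riemannZeta s‖ = ‖(riemannZeta s - 1 + 1 / (1 - s)) + 1 - 1 / (1 - s)‖ := by rw [← e]
        _ ≤ ‖(riemannZeta s - 1 + 1 / (1 - s)) + 1‖ + ‖(1 : ℂ) / (1 - s)‖ := norm_sub_le _ _
        _ ≤ _ := by gcongr; exact norm_add_le _ _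
    have hb : 1 / 2 + ‖s‖ / (2 * σ) ≤ 5 / 2 := by
      have : ‖s‖ / (2 * σ) ≤ 2 := by
        rw [div_le_iff₀ (by linarith)]; linarith
      linarith
    rw [norm_one] at htri
    linarith
  have hpos : 1 ≤ 1 / (1 - σ) + 4 := by
    have : 0 < 1 / (1 - σ) := by positivity
    linarith
  exact log_norm_le_log hpos hζ

end pointwise

/-! ## The three correction integrals -/

section corrections

variable {a t : ℝ}

/-- `e^{−|u|}` is integrable. [folklore] -/
theorem integrable_exp_neg_abs : Integrable fun u : ℝ ↦ Real.exp (-|u|) := by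
  have h := integrable_exp_neg_mul_abs (a := 1) one_pos
  exact h.congr (ae_of_all _ fun u ↦ by simp)

/-- `e^{−|u|/2}` is integrable. [folklore] -/
theorem integrable_exp_neg_abs_half : Integrable fun u : ℝ ↦ Real.exp (-(|u| / 2)) := by
  have h := integrable_exp_neg_mul_abs (a := 1 / 2) (by norm_num)
  refine h.congr (ae_of_all _ fun u ↦ ?_)
  dsimp only
  congr 1
  ring

/-- `u/cosh²u` is integrable. [folklore] -/
theorem integrable_id_div_cosh_sq : Integrable fun u : ℝ ↦ u / Real.cosh u ^ 2 :=
  (integrable_pow_div_cosh_sq 1).congr (ae_of_all _ fun u ↦ by simp)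

/-- `2ⁿ e^{−n} ≤ 1` (`2 ≤ e`). [folklore] -/
theorem two_pow_mul_exp_neg_le_one (n : ℕ) : (2 : ℝ) ^ n * Real.exp (-(n : ℝ)) ≤ 1 := by
  have h2 : (2 : ℝ) ≤ Real.exp 1 := by have := Real.add_one_le_exp (1 : ℝ); norm_num at this; linarith
  have h : (2 : ℝ) ^ n ≤ Real.exp n := by
    calc (2 : ℝ) ^ n ≤ Real.exp 1 ^ n := pow_le_pow_left₀ (by norm_num) h2 n
      _ = Real.exp n := by rw [← Real.exp_nat_mul]; ring_nf
  have hE : 0 < Real.exp (n : ℝ) := Real.exp_pos _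
  rw [Real.exp_neg, ← div_eq_mul_inv, div_le_one hE]
  exact h


/-- **Lower range**: `∫ max(−au/t − 2, 0)/cosh²u du ≤ (8a/t) e^{−4t/a}` (the source has
`(a/t)e^{−4t/a}`). [cite: Ford2002Millennium, proof of Lemma 3.4] -/
theorem integral_lower_excess_le (ha : 0 < a) (ht : 0 < t) :
    ∫ u : ℝ, max (-(a * u / t) - 2) 0 / Real.cosh u ^ 2 ≤ 8 * a / t * Real.exp (-(4 * t / a)) := by
  set c₀ : ℝ := 2 * t / a with hc₀
  have hK : 0 ≤ 4 * a / t * Real.exp (-(4 * t / a)) := by positivity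
  -- dominating function and its integral
  have hG : Integrable fun u : ℝ ↦ 4 * a / t * Real.exp (-(4 * t / a)) * Real.exp (-|u + c₀|) :=
    (integrable_exp_neg_abs.comp_add_right c₀).const_mul _
  have hGint : ∫ u : ℝ, 4 * a / t * Real.exp (-(4 * t / a)) * Real.exp (-|u + c₀|)
      = 8 * a / t * Real.exp (-(4 * t / a)) := by
    rw [integral_const_mul, integral_add_right_eq_self (fun u ↦ Real.exp (-|u|)) c₀,
      integral_exp_neg_abs]
    ring
  rw [← hGint]
  refine integral_mono_of_nonneg (ae_of_all _ fun u ↦ ?_) hG (ae_of_all _ fun u ↦ ?_)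
  · exact div_nonneg (le_max_right _ _) (by positivity)
  · dsimp only
    rcases le_or_gt (-(a * u / t) - 2) 0 with h | h
    · rw [max_eq_right h, zero_div]; positivity
    · have h1 : a * u / t < -2 := by linarith
      rw [div_lt_iff₀ ht] at h1
      have hu : u + c₀ < 0 := by
        by_contra hh
        have hh' : 0 ≤ u + c₀ := not_lt.1 hh
        have e : a * (u + c₀) = a * u + 2 * t := by simp only [hc₀]; field_simp
        nlinarith [mul_nonneg ha.le hh']
      set v : ℝ := -(u + c₀) with hv
      have hv0 : 0 < v := by simp only [hv]; linarith
      have hmax : max (-(a * u / t) - 2) 0 = a / t * v := by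
        rw [max_eq_left h.le, hv, hc₀]; field_simp; ring
      have habs : |u| = v + c₀ := by
        have : u < 0 := by have : 0 < c₀ := by positivity
                           linarith
        rw [abs_of_neg this, hv]; ring
      have habs' : |u + c₀| = v := by rw [abs_of_neg hu, hv]
      have hw := one_div_cosh_sq_le u
      have hve : v * Real.exp (-v) ≤ 1 := by simpa using pow_mul_exp_neg_le 1 hv0.le
      rw [hmax, habs']
      rw [habs] at hw
      have hav : 0 ≤ a / t * v := by positivity
      calc a / t * v / Real.cosh u ^ 2 = a / t * v * (1 / Real.cosh u ^ 2) := by ring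
        _ ≤ a / t * v * (4 * Real.exp (-(2 * (v + c₀)))) := mul_le_mul_of_nonneg_left hw hav
        _ = 4 * a / t * Real.exp (-(4 * t / a)) * (v * Real.exp (-v) * Real.exp (-v)) := by
            rw [show -(2 * (v + c₀)) = -(4 * t / a) + -v + -v by simp only [hc₀]; ring,
              Real.exp_add, Real.exp_add]
            ring
        _ ≤ 4 * a / t * Real.exp (-(4 * t / a)) * (1 * Real.exp (-v)) :=
            mul_le_mul_of_nonneg_left (mul_le_mul_of_nonneg_right hve (Real.exp_pos _).le) hK
        _ = 4 * a / t * Real.exp (-(4 * t / a)) * Real.exp (-v) := by ring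

/-- **The window `|t + au| < 1`**: `∫ 𝟙_{|t+au|<1} L/cosh²u du ≤ L · 4e^{−2(t−1)/a} · (2/a)` for a
constant `L ≥ 0` (the window has length `2/a` and sits at `|u| ≥ (t−1)/a`).
[cite: Ford2002Millennium, proof of Lemma 3.4] -/
theorem integral_near_le_of_const {L : ℝ} (hL : 0 ≤ L) (ha : 0 < a) (ht : 3 ≤ t) :
    ∫ u : ℝ, (Set.Ioo ((-t - 1) / a) ((-t + 1) / a)).indicator (fun _ ↦ L) u
        / Real.cosh u ^ 2
      ≤ L * (4 * Real.exp (-(2 * ((t - 1) / a)))) * (2 / a) := by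
  set K : ℝ := L * (4 * Real.exp (-(2 * ((t - 1) / a)))) with hK
  have hK0 : 0 ≤ K := by positivity
  have hle : (-t - 1) / a ≤ (-t + 1) / a := div_le_div_of_nonneg_right (by linarith) ha.le
  have hvol : volume (Set.Ioo ((-t - 1) / a) ((-t + 1) / a)) = ENNReal.ofReal (2 / a) := by
    rw [Real.volume_Ioo]; congr 1; field_simp; ring
  have hG : Integrable ((Set.Ioo ((-t - 1) / a) ((-t + 1) / a)).indicator fun _ ↦ K) :=
    (integrableOn_const (by rw [hvol]; exact ENNReal.ofReal_ne_top)).integrable_indicator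
      measurableSet_Ioo
  have hGint : ∫ u, (Set.Ioo ((-t - 1) / a) ((-t + 1) / a)).indicator (fun _ ↦ K) u = K * (2 / a) := by
    rw [integral_indicator_const _ measurableSet_Ioo, Real.volume_real_Ioo_of_le hle, smul_eq_mul]
    field_simp
    ring
  rw [← hGint]
  refine integral_mono_of_nonneg (ae_of_all _ fun u ↦ ?_) hG (ae_of_all _ fun u ↦ ?_)
  · exact div_nonneg (Set.indicator_nonneg (fun _ _ ↦ hL) _) (by positivity)
  · dsimp only
    by_cases hu : u ∈ Set.Ioo ((-t - 1) / a) ((-t + 1) / a)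
    · rw [Set.indicator_of_mem hu, Set.indicator_of_mem hu]
      have hu2 : u < (-t + 1) / a := hu.2
      have hneg : u < 0 := hu2.trans_le (div_nonpos_iff.2 (Or.inr ⟨by linarith, ha.le⟩))
      have habs : (t - 1) / a ≤ |u| := by
        rw [abs_of_neg hneg]
        have : (-t + 1) / a = -((t - 1) / a) := by ring
        linarith
      have hw := one_div_cosh_sq_le u
      have hexp : Real.exp (-(2 * |u|)) ≤ Real.exp (-(2 * ((t - 1) / a))) :=
        Real.exp_le_exp.2 (by linarith)
      calc L / Real.cosh u ^ 2 = L * (1 / Real.cosh u ^ 2) := by ring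
        _ ≤ L * (4 * Real.exp (-(2 * |u|))) := mul_le_mul_of_nonneg_left hw hL
        _ ≤ K := by rw [hK]; gcongr
    · rw [Set.indicator_of_notMem hu, Set.indicator_of_notMem hu, zero_div]

/-- **Near the real axis**: `∫ 𝟙_{|t + au| < 1} log(t + 4)/cosh²u du ≤ log(t + 4) · 4e^{−2(t−1)/a} · (2/a)`.
[cite: Ford2002Millennium, proof of Lemma 3.4] -/
theorem integral_near_le (ha : 0 < a) (ht : 3 ≤ t) :
    ∫ u : ℝ, (Set.Ioo ((-t - 1) / a) ((-t + 1) / a)).indicator (fun _ ↦ Real.log (t + 4)) u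
        / Real.cosh u ^ 2
      ≤ Real.log (t + 4) * (4 * Real.exp (-(2 * ((t - 1) / a)))) * (2 / a) :=
  integral_near_le_of_const (Real.log_nonneg (by linarith)) ha ht

/-- `|x − x²/2 + x³/3| ≤ 3r³` when `|x| ≤ r` and `r ≥ 1`. [folklore] -/
theorem abs_cubic_le {x r : ℝ} (hx : |x| ≤ r) (hr : 1 ≤ r) :
    |x - x ^ 2 / 2 + x ^ 3 / 3| ≤ 3 * r ^ 3 := by
  have h0 : 0 ≤ |x| := abs_nonneg x
  have h1 : |x - x ^ 2 / 2 + x ^ 3 / 3| ≤ |x| + |x| ^ 2 / 2 + |x| ^ 3 / 3 := by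
    rw [sub_eq_add_neg]
    refine (abs_add_three _ _ _).trans (le_of_eq ?_)
    rw [abs_neg, abs_div, abs_div, abs_pow, abs_pow, abs_of_pos (by norm_num : (0:ℝ) < 2),
      abs_of_pos (by norm_num : (0:ℝ) < 3)]
  have h2 : |x| ^ 2 ≤ r ^ 2 := pow_le_pow_left₀ h0 hx 2
  have h3 : |x| ^ 3 ≤ r ^ 3 := pow_le_pow_left₀ h0 hx 3
  have h4 : r ≤ r ^ 3 := le_self_pow₀ hr (by norm_num)
  have h5 : r ^ 2 ≤ r ^ 3 := pow_le_pow_right₀ hr (by norm_num)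
  linarith

/-- **Upper range**: `∫ 𝟙_{u ≥ (3−t)/a} (x − x²/2 + x³/3)/cosh²u du ≤ −a²/(4t²) + 288 e^{−(t−3)/(2a)}`
(`x = au/t`; from `∫ u/cosh² = ∫ u³/cosh² = 0`, `∫ u²/cosh² ≥ 1/2` and a crude bound for the
cut-off piece; the source has `−π²a²/(12t²) + 48a³e^{−4t+12}`). [cite: Ford2002Millennium, proof of Lemma 3.4] -/
theorem integral_upper_le (ha : 0 < a) (ha2 : a ≤ 1 / 2) (ht : 100 ≤ t) :
    ∫ u : ℝ, (Set.Ici ((3 - t) / a)).indicator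
        (fun u ↦ a * u / t - (a * u / t) ^ 2 / 2 + (a * u / t) ^ 3 / 3) u / Real.cosh u ^ 2
      ≤ -(a ^ 2 / (4 * t ^ 2)) + 288 * Real.exp (-((t - 3) / (2 * a))) := by
  set u₀ : ℝ := (3 - t) / a with hu₀
  set g : ℝ → ℝ := fun u ↦ a * u / t - (a * u / t) ^ 2 / 2 + (a * u / t) ^ 3 / 3 with hg
  have ht0 : 0 < t := by linarith
  have hat : a / t ≤ 1 := by rw [div_le_one ht0]; linarith
  have hxu : ∀ u : ℝ, |a * u / t| ≤ |u| := by
    intro u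
    rw [show a * u / t = a / t * u by ring, abs_mul, abs_of_pos (div_pos ha ht0)]
    exact mul_le_of_le_one_left (abs_nonneg u) hat
  -- integrability
  have hgc : Continuous g := by simp only [hg]; fun_prop
  have hgI : Integrable fun u ↦ g u / Real.cosh u ^ 2 := by
    refine integrable_div_cosh_sq_of_le hgc.aestronglyMeasurable 3 (C := 3) fun u ↦ ?_
    have hu1 : 1 ≤ 1 + |u| := by linarith [abs_nonneg u]
    have hx : |a * u / t| ≤ 1 + |u| := by linarith [hxu u, abs_nonneg u]
    simp only [hg]
    exact abs_cubic_le hx hu1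
  have hTI : Integrable fun u ↦ (Set.Iio u₀).indicator g u / Real.cosh u ^ 2 := by
    have h := hgI.indicator (measurableSet_Iio : MeasurableSet (Set.Iio u₀))
    refine h.congr (ae_of_all _ fun u ↦ ?_)
    by_cases hu : u ∈ Set.Iio u₀
    · simp [Set.indicator_of_mem hu]
    · simp [Set.indicator_of_notMem hu]
  -- decomposition `𝟙_{≥ u₀} g = g − 𝟙_{< u₀} g`
  have hdecomp : (fun u ↦ (Set.Ici u₀).indicator g u / Real.cosh u ^ 2) =
      fun u ↦ g u / Real.cosh u ^ 2 - (Set.Iio u₀).indicator g u / Real.cosh u ^ 2 := by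
    funext u
    rw [← Set.compl_Iio, Set.indicator_compl, Pi.sub_apply, sub_div]
  rw [hdecomp, integral_sub hgI hTI]
  -- the main piece
  have hmain : ∫ u, g u / Real.cosh u ^ 2 ≤ -(a ^ 2 / (4 * t ^ 2)) := by
    have e : (fun u ↦ g u / Real.cosh u ^ 2) = fun u ↦
        a / t * (u / Real.cosh u ^ 2) - a ^ 2 / (2 * t ^ 2) * (u ^ 2 / Real.cosh u ^ 2)
          + a ^ 3 / (3 * t ^ 3) * (u ^ 3 / Real.cosh u ^ 2) := by
      funext u; simp only [hg]; field_simp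
    have h1 : Integrable fun u : ℝ ↦ a / t * (u / Real.cosh u ^ 2) := integrable_id_div_cosh_sq.const_mul _
    have h2 : Integrable fun u : ℝ ↦ a ^ 2 / (2 * t ^ 2) * (u ^ 2 / Real.cosh u ^ 2) :=
      (integrable_pow_div_cosh_sq 2).const_mul _
    have h3 : Integrable fun u : ℝ ↦ a ^ 3 / (3 * t ^ 3) * (u ^ 3 / Real.cosh u ^ 2) :=
      (integrable_pow_div_cosh_sq 3).const_mul _
    have h12 : Integrable fun u : ℝ ↦ a / t * (u / Real.cosh u ^ 2)
        - a ^ 2 / (2 * t ^ 2) * (u ^ 2 / Real.cosh u ^ 2) := h1.sub h2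
    rw [e, integral_add h12 h3, integral_sub h1 h2, integral_const_mul, integral_const_mul,
      integral_const_mul, integral_id_div_cosh_sq, integral_cube_div_cosh_sq]
    have hm := half_le_integral_sq_div_cosh_sq
    have hc : 0 ≤ a ^ 2 / (2 * t ^ 2) := by positivity
    have := mul_le_mul_of_nonneg_left hm hc
    have e2 : a ^ 2 / (2 * t ^ 2) * (1 / 2) = a ^ 2 / (4 * t ^ 2) := by ring
    linarith
  -- the cut-off piece
  have htail : -(∫ u, (Set.Iio u₀).indicator g u / Real.cosh u ^ 2)
      ≤ 288 * Real.exp (-((t - 3) / (2 * a))) := by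
    rw [← integral_neg]
    have hE0 : 0 ≤ 72 * Real.exp (-((t - 3) / (2 * a))) := by positivity
    have hH : Integrable fun u ↦ 72 * Real.exp (-((t - 3) / (2 * a))) * Real.exp (-(|u| / 2)) :=
      integrable_exp_neg_abs_half.const_mul _
    have hHint : ∫ u, 72 * Real.exp (-((t - 3) / (2 * a))) * Real.exp (-(|u| / 2))
        = 288 * Real.exp (-((t - 3) / (2 * a))) := by
      rw [integral_const_mul, integral_exp_neg_abs_half]; ring
    rw [← hHint]
    refine integral_mono hTI.neg hH fun u ↦ ?_
    dsimp only
    by_cases hu : u ∈ Set.Iio u₀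
    · rw [Set.indicator_of_mem hu]
      have hu' : u < (3 - t) / a := hu
      have hU0 : 194 ≤ (t - 3) / a := by
        rw [le_div_iff₀ ha]; nlinarith
      have hneg : u < 0 := hu'.trans_le (by
        rw [show (3 - t) / a = -((t - 3) / a) by ring]; linarith)
      have hU : (t - 3) / a ≤ |u| := by
        rw [abs_of_neg hneg, show (3 - t) / a = -((t - 3) / a) by ring] at *; linarith
      have hu1 : 1 ≤ |u| := by linarith
      have hg3 : |g u| ≤ 3 * |u| ^ 3 := by simp only [hg]; exact abs_cubic_le (hxu u) hu1
      have hw := one_div_cosh_sq_le u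
      have h6 : |u| ^ 3 * Real.exp (-|u|) ≤ 6 := by
        have := pow_mul_exp_neg_le 3 (abs_nonneg u); norm_num [Nat.factorial] at this; exact this
      have hsplit : Real.exp (-(2 * |u|)) = Real.exp (-|u|) * (Real.exp (-(|u| / 2)) * Real.exp (-(|u| / 2))) := by
        rw [← Real.exp_add, ← Real.exp_add]; ring_nf
      have hhalf : Real.exp (-(|u| / 2)) ≤ Real.exp (-((t - 3) / (2 * a))) := by
        refine Real.exp_le_exp.2 ?_
        have : (t - 3) / (2 * a) = ((t - 3) / a) / 2 := by field_simp
        rw [this]; linarith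
      have hc2 : 0 < Real.cosh u ^ 2 := by positivity
      calc -(g u / Real.cosh u ^ 2) ≤ |g u / Real.cosh u ^ 2| := neg_le_abs _
        _ = |g u| * (1 / Real.cosh u ^ 2) := by rw [abs_div, abs_of_pos hc2]; ring
        _ ≤ (3 * |u| ^ 3) * (4 * Real.exp (-(2 * |u|))) :=
            mul_le_mul hg3 hw (by positivity) (by positivity)
        _ = 12 * (|u| ^ 3 * Real.exp (-|u|)) * Real.exp (-(|u| / 2)) * Real.exp (-(|u| / 2)) := by
            rw [hsplit]; ring
        _ ≤ 12 * 6 * Real.exp (-((t - 3) / (2 * a))) * Real.exp (-(|u| / 2)) := by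
            gcongr
        _ = 72 * Real.exp (-((t - 3) / (2 * a))) * Real.exp (-(|u| / 2)) := by ring
    · rw [Set.indicator_of_notMem hu, zero_div, neg_zero]; positivity
  linarith

end corrections

/-! ## Numerics: the three small terms against `a²/(12t²)` -/

section numerics

variable {a t : ℝ}

/-- `(8a/t)e^{−4t/a} ≤ a²/(12t²)` for `0 < a ≤ 1/2`, `t ≥ 100`. [folklore] -/
theorem numerics_lower (ha : 0 < a) (ha2 : a ≤ 1 / 2) (ht : 100 ≤ t) :
    8 * a / t * Real.exp (-(4 * t / a)) ≤ a ^ 2 / (12 * t ^ 2) := by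
  have ht0 : 0 < t := by linarith
  set x : ℝ := 4 * t / a with hx
  have hx0 : 0 < x := by positivity
  have h2 : x ^ 2 * Real.exp (-x) ≤ 2 := by
    have := pow_mul_exp_neg_le 2 hx0.le
    norm_num [Nat.factorial] at this
    exact this
  have hexp : Real.exp (-x) ≤ 2 / x ^ 2 := by
    rw [le_div_iff₀ (by positivity)]; linarith [mul_comm (x ^ 2) (Real.exp (-x))]
  calc 8 * a / t * Real.exp (-x) ≤ 8 * a / t * (2 / x ^ 2) := by gcongr
    _ = a ^ 3 / t ^ 3 := by simp only [hx]; field_simp; ring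
    _ ≤ a ^ 2 / (12 * t ^ 2) := by
        rw [div_le_div_iff₀ (by positivity) (by positivity)]
        calc a ^ 3 * (12 * t ^ 2) = a ^ 2 * t ^ 2 * (12 * a) := by ring
          _ ≤ a ^ 2 * t ^ 2 * t := by gcongr; linarith
          _ = a ^ 2 * t ^ 3 := by ring

/-- `288 e^{−(t−3)/(2a)} ≤ a²/(12t²)` for `0 < a ≤ 1/2`, `t ≥ 100`. [folklore] -/
theorem numerics_upper (ha : 0 < a) (ha2 : a ≤ 1 / 2) (ht : 100 ≤ t) :
    288 * Real.exp (-((t - 3) / (2 * a))) ≤ a ^ 2 / (12 * t ^ 2) := by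
  have ht0 : 0 < t := by linarith
  have ht3 : 0 < t - 3 := by linarith
  set x : ℝ := (t - 3) / (2 * a) with hx
  have hx0 : 0 < x := by positivity
  have hxt : t - 3 ≤ x := by
    rw [hx, le_div_iff₀ (by positivity)]; nlinarith
  have hsplit : Real.exp (-x) = Real.exp (-(x / 2)) * Real.exp (-(x / 2)) := by
    rw [← Real.exp_add]; ring_nf
  have h1 : Real.exp (-(x / 2)) ≤ 8 / x ^ 2 := by
    have h := pow_mul_exp_neg_le 2 (x := x / 2) (by positivity)
    norm_num [Nat.factorial] at h
    rw [le_div_iff₀ (by positivity)]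
    nlinarith [h]
  have h48 : Real.exp (-((48 : ℕ) : ℝ)) ≤ 1 / 2 ^ 48 := by
    have h := two_pow_mul_exp_neg_le_one 48
    rw [le_div_iff₀ (by positivity), mul_comm]; exact h
  have h2 : Real.exp (-(x / 2)) ≤ 1 / 2 ^ 48 := by
    refine le_trans (Real.exp_le_exp.2 ?_) h48
    push_cast; linarith
  calc 288 * Real.exp (-x) = 288 * (Real.exp (-(x / 2)) * Real.exp (-(x / 2))) := by rw [hsplit]
    _ ≤ 288 * (8 / x ^ 2 * (1 / 2 ^ 48)) := by gcongr
    _ = 9216 * a ^ 2 / (2 ^ 48 * (t - 3) ^ 2) := by simp only [hx]; field_simp; ring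
    _ ≤ a ^ 2 / (12 * t ^ 2) := by
        rw [div_le_div_iff₀ (by positivity) (by positivity)]
        have hq : t ^ 2 ≤ 2 * (t - 3) ^ 2 := by nlinarith
        calc 9216 * a ^ 2 * (12 * t ^ 2) = a ^ 2 * 110592 * t ^ 2 := by ring
          _ ≤ a ^ 2 * 110592 * (2 * (t - 3) ^ 2) := by gcongr
          _ = a ^ 2 * (t - 3) ^ 2 * 221184 := by ring
          _ ≤ a ^ 2 * (t - 3) ^ 2 * 2 ^ 48 := by gcongr; norm_num
          _ = a ^ 2 * (2 ^ 48 * (t - 3) ^ 2) := by ring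

/-- `log(t+4) · 4e^{−2(t−1)/a} · (2/a) ≤ (1/(10 log t)) · a²/(12t²)` for `0 < a ≤ 1/2`, `t ≥ 100`.
[folklore] -/
theorem numerics_near (ha : 0 < a) (ha2 : a ≤ 1 / 2) (ht : 100 ≤ t) :
    Real.log (t + 4) * (4 * Real.exp (-(2 * ((t - 1) / a)))) * (2 / a)
      ≤ 1 / (10 * Real.log t) * (a ^ 2 / (12 * t ^ 2)) := by
  have ht0 : 0 < t := by linarith
  have ht1 : 0 < t - 1 := by linarith
  have hℓ : 0 < Real.log t := Real.log_pos (by linarith)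
  have hℓt : Real.log t ≤ t := by have := Real.log_le_sub_one_of_pos ht0; linarith
  have hlog4 : Real.log (t + 4) ≤ 2 * t := by
    have := Real.log_le_sub_one_of_pos (by linarith : 0 < t + 4); linarith
  have hlog4pos : 0 < Real.log (t + 4) := Real.log_pos (by linarith)
  set x : ℝ := (t - 1) / a with hx
  have hx0 : 0 < x := by positivity
  have hxt : 2 * (t - 1) ≤ x := by
    rw [hx, le_div_iff₀ ha]; nlinarith
  -- `RHS ≥ a²/(120 t³)`
  have hR : a ^ 2 / (120 * t ^ 3) ≤ 1 / (10 * Real.log t) * (a ^ 2 / (12 * t ^ 2)) := by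
    rw [div_mul_div_comm, one_mul, div_le_div_iff₀ (by positivity) (by positivity)]
    calc a ^ 2 * (10 * Real.log t * (12 * t ^ 2)) = a ^ 2 * (120 * t ^ 2) * Real.log t := by ring
      _ ≤ a ^ 2 * (120 * t ^ 2) * t := by gcongr
      _ = a ^ 2 * (120 * t ^ 3) := by ring
  refine le_trans ?_ hR
  -- the two factors `e^{-x}`
  have hsplit : Real.exp (-(2 * x)) = Real.exp (-x) * Real.exp (-x) := by
    rw [← Real.exp_add]; ring_nf
  have h6 : Real.exp (-x) ≤ 6 / x ^ 3 := by
    have h := pow_mul_exp_neg_le 3 hx0.le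
    norm_num [Nat.factorial] at h
    rw [le_div_iff₀ (by positivity)]
    linarith [mul_comm (x ^ 3) (Real.exp (-x))]
  have h7 : Real.exp (-x) ≤ Real.exp (-(2 * (t - 1))) := Real.exp_le_exp.2 (by linarith)
  have h8 : t * Real.exp (-(2 * (t - 1))) ≤ 1 / 2 ^ 98 := by
    rw [show -(2 * (t - 1)) = -t + -(t - 2) by ring, Real.exp_add]
    have ha1 : t * Real.exp (-t) ≤ 1 := by simpa using pow_mul_exp_neg_le 1 ht0.le
    have h98 : Real.exp (-((98 : ℕ) : ℝ)) ≤ 1 / 2 ^ 98 := by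
      have h := two_pow_mul_exp_neg_le_one 98
      rw [le_div_iff₀ (by positivity), mul_comm]; exact h
    have hb : Real.exp (-(t - 2)) ≤ 1 / 2 ^ 98 :=
      le_trans (Real.exp_le_exp.2 (by push_cast; linarith)) h98
    calc t * (Real.exp (-t) * Real.exp (-(t - 2))) = (t * Real.exp (-t)) * Real.exp (-(t - 2)) := by
          ring
      _ ≤ 1 * (1 / 2 ^ 98) := mul_le_mul ha1 hb (Real.exp_pos _).le zero_le_one
      _ = 1 / 2 ^ 98 := by ring
  calc Real.log (t + 4) * (4 * Real.exp (-(2 * x))) * (2 / a)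
      ≤ (2 * t) * (4 * Real.exp (-(2 * x))) * (2 / a) := by gcongr
    _ = 16 / a * (Real.exp (-x) * (t * Real.exp (-x))) := by rw [hsplit]; ring
    _ ≤ 16 / a * ((6 / x ^ 3) * (t * Real.exp (-(2 * (t - 1))))) := by gcongr
    _ ≤ 16 / a * ((6 / x ^ 3) * (1 / 2 ^ 98)) := by gcongr
    _ = 96 * a ^ 2 / (2 ^ 98 * (t - 1) ^ 3) := by simp only [hx]; field_simp; ring
    _ ≤ a ^ 2 / (120 * t ^ 3) := by
        rw [div_le_div_iff₀ (by positivity) (by positivity)]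
        have hq : t ^ 3 ≤ 2 * (t - 1) ^ 3 := by
          nlinarith [mul_nonneg (mul_nonneg ht0.le ht0.le) (by linarith : (0:ℝ) ≤ t - 6)]
        calc 96 * a ^ 2 * (120 * t ^ 3) = a ^ 2 * 11520 * t ^ 3 := by ring
          _ ≤ a ^ 2 * 11520 * (2 * (t - 1) ^ 3) := by gcongr
          _ = a ^ 2 * (t - 1) ^ 3 * 23040 := by ring
          _ ≤ a ^ 2 * (t - 1) ^ 3 * 2 ^ 98 := by gcongr; norm_num
          _ = a ^ 2 * (2 ^ 98 * (t - 1) ^ 3) := by ring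

/-- `(t/a + 2) · 4e^{−2(t−1)/a} · (2/a) ≤ (1/(10 log t)) · a²/(12t²)` for `0 < a ≤ 1/2`, `t ≥ 100`
(the window bound of `integral_log_norm_zeta_div_cosh_sq_le'`). [folklore] -/
theorem numerics_near' (ha : 0 < a) (ha2 : a ≤ 1 / 2) (ht : 100 ≤ t) :
    (t / a + 2) * (4 * Real.exp (-(2 * ((t - 1) / a)))) * (2 / a)
      ≤ 1 / (10 * Real.log t) * (a ^ 2 / (12 * t ^ 2)) := by
  have ht0 : 0 < t := by linarith
  have ht1 : 0 < t - 1 := by linarith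
  have hℓ : 0 < Real.log t := Real.log_pos (by linarith)
  have hℓt : Real.log t ≤ t := by have := Real.log_le_sub_one_of_pos ht0; linarith
  set x : ℝ := (t - 1) / a with hx
  have hx0 : 0 < x := by positivity
  have hxa : x * a = t - 1 := by rw [hx]; field_simp
  have hxt : 2 * (t - 1) ≤ x := by
    rw [hx, le_div_iff₀ ha]; nlinarith
  have hx99 : 99 ≤ x / 2 := by linarith
  -- `t/a + 2 ≤ 2x + 6 ≤ 3x`:  t/a = x + 1/a ≤ x + x/(t-1) ≤ 2x
  have hta : t / a + 2 ≤ 3 * x := by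
    have h1 : t / a = x + 1 / a := by rw [hx]; field_simp; ring
    have h2 : 1 / a ≤ x := by
      rw [hx, div_le_div_iff_of_pos_right ha]; linarith
    linarith
  -- `RHS ≥ a²/(120 t³)`
  have hR : a ^ 2 / (120 * t ^ 3) ≤ 1 / (10 * Real.log t) * (a ^ 2 / (12 * t ^ 2)) := by
    rw [div_mul_div_comm, one_mul, div_le_div_iff₀ (by positivity) (by positivity)]
    calc a ^ 2 * (10 * Real.log t * (12 * t ^ 2)) = a ^ 2 * (120 * t ^ 2) * Real.log t := by ring
      _ ≤ a ^ 2 * (120 * t ^ 2) * t := by gcongr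
      _ = a ^ 2 * (120 * t ^ 3) := by ring
  refine le_trans ?_ hR
  -- `x⁵ e^{-x} = 32 (x/2)^5 e^{-x/2} e^{-x/2} ≤ 32 · 120 · 2^{-198}`
  have hsplit : Real.exp (-(2 * x)) = Real.exp (-x) * Real.exp (-x) := by
    rw [← Real.exp_add]; ring_nf
  have hsplit2 : Real.exp (-x) = Real.exp (-(x / 2)) * Real.exp (-(x / 2)) := by
    rw [← Real.exp_add]; ring_nf
  have h5 : (x / 2) ^ 5 * Real.exp (-(x / 2)) ≤ 120 := by
    have h := pow_mul_exp_neg_le 5 (x := x / 2) (by positivity)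
    norm_num [Nat.factorial] at h
    exact h
  have h99 : Real.exp (-(x / 2)) ≤ 1 / 2 ^ 99 := by
    have h := two_pow_mul_exp_neg_le_one 99
    have h' : Real.exp (-(x / 2)) ≤ Real.exp (-((99 : ℕ) : ℝ)) := Real.exp_le_exp.2 (by push_cast; linarith)
    refine h'.trans ?_
    rw [le_div_iff₀ (by positivity), mul_comm]; exact h
  have hx5 : x ^ 5 * Real.exp (-x) ≤ 32 * 120 * (1 / 2 ^ 99) := by
    rw [hsplit2]
    calc x ^ 5 * (Real.exp (-(x / 2)) * Real.exp (-(x / 2)))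
        = 32 * ((x / 2) ^ 5 * Real.exp (-(x / 2))) * Real.exp (-(x / 2)) := by ring
      _ ≤ 32 * 120 * (1 / 2 ^ 99) := by
          refine mul_le_mul (mul_le_mul_of_nonneg_left h5 (by norm_num)) h99 (Real.exp_pos _).le
            (by positivity)
  have hex1 : Real.exp (-x) ≤ 1 := by rw [Real.exp_le_one_iff]; linarith
  -- main chain
  have hlhs : (t / a + 2) * (4 * Real.exp (-(2 * x))) * (2 / a) ≤ 24 * x * Real.exp (-x) * Real.exp (-x) / a := by
    rw [hsplit]
    have : (t / a + 2) * (4 * (Real.exp (-x) * Real.exp (-x))) * (2 / a) =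
        (t / a + 2) * 8 * Real.exp (-x) * Real.exp (-x) / a := by ring
    rw [this, div_le_div_iff_of_pos_right ha]
    have := mul_le_mul_of_nonneg_right hta (by positivity : 0 ≤ 8 * Real.exp (-x) * Real.exp (-x))
    nlinarith [Real.exp_pos (-x)]
  refine hlhs.trans ?_
  -- 24 x e^{-x} e^{-x} / a ≤ a²/(120 t³)  ⟸  2880 x t³ e^{-x} e^{-x} ≤ a³, with a = (t-1)/x
  rw [div_le_div_iff₀ ha (by positivity)]
  have hax : (t - 1) / x = a := by rw [hx]; field_simp
  -- we show: 24 x e^{-x} e^{-x} (120 t³) ≤ (t-1)³/x³ · ... using x⁵ e^{-x} tiny and t ≤ 2(t-1)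
  have hxpos : 0 < x ^ 3 := by positivity
  have key : 24 * x * Real.exp (-x) * Real.exp (-x) * (120 * t ^ 3) * x ^ 3 ≤ (t - 1) ^ 3 := by
    have h1 : 24 * x * Real.exp (-x) * Real.exp (-x) * (120 * t ^ 3) * x ^ 3 ≤
        2880 * t ^ 3 * (x ^ 5 * Real.exp (-x)) := by
      have e : 24 * x * Real.exp (-x) * Real.exp (-x) * (120 * t ^ 3) * x ^ 3 =
          2880 * t ^ 3 * (x ^ 5 * Real.exp (-x)) * (Real.exp (-x) / x) := by
        field_simp; ring
      rw [e]
      have hq : Real.exp (-x) / x ≤ 1 := by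
        rw [div_le_one hx0]; linarith
      have h0 : 0 ≤ 2880 * t ^ 3 * (x ^ 5 * Real.exp (-x)) := by positivity
      nlinarith
    have h2 : 2880 * t ^ 3 * (x ^ 5 * Real.exp (-x)) ≤ 2880 * t ^ 3 * (32 * 120 * (1 / 2 ^ 99)) :=
      mul_le_mul_of_nonneg_left hx5 (by positivity)
    have h3 : t ^ 3 ≤ 2 * (t - 1) ^ 3 := by
      nlinarith [mul_nonneg (mul_nonneg ht0.le ht0.le) (by linarith : (0:ℝ) ≤ t - 6)]
    have h4 : 2880 * t ^ 3 * (32 * 120 * (1 / 2 ^ 99)) ≤ (t - 1) ^ 3 := by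
      have : 2880 * (2 * (t - 1) ^ 3) * (32 * 120 * (1 / 2 ^ 99)) ≤ (t - 1) ^ 3 := by
        rw [show 2880 * (2 * (t - 1) ^ 3) * (32 * 120 * (1 / 2 ^ 99)) =
          (t - 1) ^ 3 * (2880 * 2 * 32 * 120 / 2 ^ 99) by ring]
        have hc : (2880 : ℝ) * 2 * 32 * 120 / 2 ^ 99 ≤ 1 := by norm_num
        nlinarith [pow_pos ht1 3]
      nlinarith [pow_pos ht1 3]
    linarith
  calc 24 * x * Real.exp (-x) * Real.exp (-x) * (120 * t ^ 3)
      = (24 * x * Real.exp (-x) * Real.exp (-x) * (120 * t ^ 3) * x ^ 3) / x ^ 3 := by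
        field_simp
    _ ≤ (t - 1) ^ 3 / x ^ 3 := div_le_div_of_nonneg_right key hxpos.le
    _ = a ^ 2 * a := by rw [← hax]; ring

end numerics

/-- The cut-off cubic `𝟙_s(u) · (x − x²/2 + x³/3)/cosh²u` (`x = au/t`, `a ≤ t`) is integrable.
[folklore] -/
theorem integrable_indicator_cubic_div_cosh_sq {a t : ℝ} (ha : 0 < a) (hat : a ≤ t)
    {s : Set ℝ} (hs : MeasurableSet s) :
    Integrable fun u : ℝ ↦ s.indicator
      (fun u ↦ a * u / t - (a * u / t) ^ 2 / 2 + (a * u / t) ^ 3 / 3) u / Real.cosh u ^ 2 := by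
  have ht0 : 0 < t := by linarith
  have hat' : a / t ≤ 1 := by rwa [div_le_one ht0]
  have hgc : Continuous fun u : ℝ ↦ a * u / t - (a * u / t) ^ 2 / 2 + (a * u / t) ^ 3 / 3 := by
    fun_prop
  refine integrable_div_cosh_sq_of_le (hgc.aestronglyMeasurable.indicator hs) 3 (C := 3) fun u ↦ ?_
  refine le_trans ?_ (abs_cubic_le (x := a * u / t) (r := 1 + |u|) ?_ (by linarith [abs_nonneg u]))
  · have h := norm_indicator_le_norm_self (s := s)
      (fun u ↦ a * u / t - (a * u / t) ^ 2 / 2 + (a * u / t) ^ 3 / 3) u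
    rw [Real.norm_eq_abs, Real.norm_eq_abs] at h
    exact h
  · rw [show a * u / t = a / t * u by ring, abs_mul, abs_of_pos (div_pos ha ht0)]
    linarith [mul_le_of_le_one_left (abs_nonneg u) hat', abs_nonneg u]

end FordL34

open FordL34 Literature.Analysis.SpecialFunctions in
/-- **Ford's Lemma 3.4 with the near-axis bound as a parameter.** As
`integral_log_norm_zeta_div_cosh_sq_le`, but instead of `σ ≤ 1 − 1/t` (used by Ford only to bound
`log|ζ(σ + iy)|` for `|y| < 1` by `log(t + 4)`) we assume directly a bound `log|ζ(σ + iy)| ≤ L`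
(`|y| < 1`) with `L ≥ 0` small enough that the window's contribution `L · 4e^{−2(t−1)/a} · (2/a)`
is at most `(1/(10 log t)) · a²/(12t²)`; both the printed case (`L = log(t + 4)`,
`numerics_near`) and the case `1 − 1/t < σ < 1` needed for small `η` in Ford's Lemma 4.1
(`L = t/a + 2`, `numerics_near'`) are instances. [cite: Ford2002Millennium, Lemma 3.4 (proof)] -/
theorem integral_log_norm_zeta_div_cosh_sq_le_of_near {σ X Y Z a t L : ℝ}
    (hX : 1 ≤ X) (hY : 0 ≤ Y) (hZ : 0 ≤ Z) (hYZ : 1 / 10 ≤ Y + Z)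
    (hyp : ∀ T : ℝ, 3 ≤ T → ∀ y : ℝ, 1 ≤ |y| → |y| ≤ T →
      ‖riemannZeta (σ + y * I)‖ ≤ X * T ^ Y * Real.log T ^ Z)
    (ha : 0 < a) (ha2 : a ≤ 1 / 2) (ht : 100 ≤ t)
    (hnear : ∀ y : ℝ, |y| < 1 → Real.log ‖riemannZeta (σ + y * I)‖ ≤ L) (hL0 : 0 ≤ L)
    (hLnum : L * (4 * Real.exp (-(2 * ((t - 1) / a)))) * (2 / a) ≤ 1 / (10 * Real.log t) * (a ^ 2 / (12 * t ^ 2))) :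
    ∫ u : ℝ, Real.log ‖riemannZeta ((σ : ℂ) + ((t + u * a : ℝ) : ℂ) * I)‖ / Real.cosh u ^ 2
      ≤ 2 * (Real.log X + Y * Real.log t + Z * Real.log (Real.log t)) := by
  have ht0 : 0 < t := by linarith
  have ht3 : 3 ≤ t := by linarith
  have hat : a ≤ t := by linarith
  -- the constants `ℓ = log t`, `M₀`, `c = Y + Z/ℓ`
  have hℓ1 : 1 < Real.log t := by
    have h : Real.exp 1 < t :=
      lt_of_lt_of_le (by have := Real.exp_one_lt_d9; norm_num at this; linarith) ht
    have := Real.log_lt_log (Real.exp_pos 1) h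
    rwa [Real.log_exp] at this
  have hℓ0 : 0 < Real.log t := by linarith
  have hlogX : 0 ≤ Real.log X := Real.log_nonneg hX
  have hlogℓ : 0 ≤ Real.log (Real.log t) := Real.log_nonneg hℓ1.le
  have hM₀ : 0 ≤ Real.log X + Y * Real.log t + Z * Real.log (Real.log t) := by
    have := mul_nonneg hY hℓ0.le
    have := mul_nonneg hZ hlogℓ
    linarith
  have hc0 : 0 < Y + Z / Real.log t := by
    have h1 : (Y + Z) / Real.log t ≤ Y + Z / Real.log t := by
      rw [add_div]; linarith [div_le_self hY hℓ1.le]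
    have h2 : 0 < (Y + Z) / Real.log t := div_pos (by linarith) hℓ0
    linarith
  have hcℓ : 1 / (10 * Real.log t) ≤ Y + Z / Real.log t := by
    have h1 : (Y + Z) / Real.log t ≤ Y + Z / Real.log t := by
      rw [add_div]; linarith [div_le_self hY hℓ1.le]
    have h2 : 1 / (10 * Real.log t) ≤ (Y + Z) / Real.log t := by
      rw [div_le_div_iff₀ (by positivity) hℓ0]; nlinarith
    linarith
  -- the majorant `A + P₃ + c (P₁ + P₄)` (written out; `A = log X + Y log t + Z log log t`,
  -- `c = Y + Z/log t`, `P₁ = max(−au/t − 2, 0)`, `P₃ = log(t+4)·𝟙_{|t+au|<1}`,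
  -- `P₄ = 𝟙_{u ≥ (3−t)/a} (x − x²/2 + x³/3)`, `x = au/t`)
  have hxu : ∀ u : ℝ, |a * u / t| ≤ |u| := by
    intro u
    rw [show a * u / t = a / t * u by ring, abs_mul, abs_of_pos (div_pos ha ht0)]
    exact mul_le_of_le_one_left (abs_nonneg u) (by rw [div_le_one ht0]; linarith)
  -- Step 1: the pointwise bound
  have hLM : ∀ u : ℝ,
      Real.log ‖riemannZeta ((σ : ℂ) + ((t + u * a : ℝ) : ℂ) * I)‖ ≤
        (Real.log X + Y * Real.log t + Z * Real.log (Real.log t))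
        + (Set.Ioo ((-t - 1) / a) ((-t + 1) / a)).indicator (fun _ ↦ L) u
        + (Y + Z / Real.log t) * (max (-(a * u / t) - 2) 0 + (Set.Ici ((3 - t) / a)).indicator
            (fun u ↦ a * u / t - (a * u / t) ^ 2 / 2 + (a * u / t) ^ 3 / 3) u) := by
    intro u
    have hP1 : 0 ≤ max (-(a * u / t) - 2) 0 := le_max_right _ _
    have hP3 : 0 ≤ (Set.Ioo ((-t - 1) / a) ((-t + 1) / a)).indicator
        (fun _ ↦ L) u := Set.indicator_nonneg (fun _ _ ↦ hL0) _
    have hcP1 := mul_nonneg hc0.le hP1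
    have hxy : (t + u * a) / t - 1 = a * u / t := by field_simp; ring
    have hP4zero : t + u * a < 3 → (Set.Ici ((3 - t) / a)).indicator
        (fun u ↦ a * u / t - (a * u / t) ^ 2 / 2 + (a * u / t) ^ 3 / 3) u = 0 := by
      intro h
      refine Set.indicator_of_notMem (fun hu ↦ ?_) _
      rw [Set.mem_Ici, div_le_iff₀ ha] at hu
      linarith
    rcases le_or_gt 3 (t + u * a) with h3 | h3
    · -- `y ≥ 3`
      have hb := log_norm_zeta_le_upper hX hY hZ ht3 hyp h3
      rw [hxy] at hb
      have hmem : u ∈ Set.Ici ((3 - t) / a) := by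
        rw [Set.mem_Ici, div_le_iff₀ ha]; linarith
      rw [Set.indicator_of_mem hmem]
      linarith
    · have hP4 := hP4zero h3
      rw [hP4, add_zero]
      rcases lt_or_ge |t + u * a| 1 with h1 | h1
      · -- `|y| < 1`
        have hb := hnear _ h1
        have hmem : u ∈ Set.Ioo ((-t - 1) / a) ((-t + 1) / a) := by
          rw [abs_lt] at h1
          constructor
          · rw [div_lt_iff₀ ha]; linarith
          · rw [lt_div_iff₀ ha]; linarith
        rw [Set.indicator_of_mem hmem]
        linarith
      · rcases le_or_gt (t + u * a) (-t) with h4 | h4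
        · -- `y ≤ -t`
          have hb := log_norm_zeta_le_lower hX hY hZ ht3 hyp h4
          have hex : -(t + u * a) / t - 1 = -(a * u / t) - 2 := by field_simp; ring
          rw [hex] at hb
          have hmax : -(a * u / t) - 2 ≤ max (-(a * u / t) - 2) 0 := le_max_left _ _
          have := mul_le_mul_of_nonneg_left hmax hc0.le
          linarith
        · -- `-t < y < 3`, `|y| ≥ 1`
          have hyt : |t + u * a| ≤ t := abs_le.2 ⟨by linarith, by linarith⟩
          have hb := log_norm_zeta_le_main hX hY hZ ht3 hyp h1 hyt
          linarith
  -- Step 2: integrability of the four pieces against `1/cosh²`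
  have q0 : Integrable fun u : ℝ ↦
      (Real.log X + Y * Real.log t + Z * Real.log (Real.log t)) / Real.cosh u ^ 2 :=
    integrable_div_cosh_sq_of_le aestronglyMeasurable_const 0
      (C := |Real.log X + Y * Real.log t + Z * Real.log (Real.log t)|) fun u ↦ by simp
  have q3 : Integrable fun u : ℝ ↦ (Set.Ioo ((-t - 1) / a) ((-t + 1) / a)).indicator
      (fun _ ↦ L) u / Real.cosh u ^ 2 := by
    refine integrable_div_cosh_sq_of_le (aestronglyMeasurable_const.indicator measurableSet_Ioo) 0
      (C := |L|) fun u ↦ ?_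
    have h := norm_indicator_le_norm_self (s := Set.Ioo ((-t - 1) / a) ((-t + 1) / a))
      (fun _ ↦ L) u
    rw [Real.norm_eq_abs, Real.norm_eq_abs] at h
    simpa using h
  have q1 : Integrable fun u : ℝ ↦ max (-(a * u / t) - 2) 0 / Real.cosh u ^ 2 := by
    refine integrable_div_cosh_sq_of_le
      ((Continuous.max (by fun_prop) continuous_const).aestronglyMeasurable) 1 (C := 2) fun u ↦ ?_
    rw [abs_of_nonneg (le_max_right _ _), pow_one]
    refine max_le ?_ (by linarith [abs_nonneg u])
    have h2 : -(a * u / t) ≤ |u| := by linarith [neg_abs_le (a * u / t), hxu u]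
    linarith [abs_nonneg u]
  have q4 : Integrable fun u : ℝ ↦ (Set.Ici ((3 - t) / a)).indicator
      (fun u ↦ a * u / t - (a * u / t) ^ 2 / 2 + (a * u / t) ^ 3 / 3) u / Real.cosh u ^ 2 :=
    integrable_indicator_cubic_div_cosh_sq ha hat measurableSet_Ici
  have q14 : Integrable fun u : ℝ ↦ max (-(a * u / t) - 2) 0 / Real.cosh u ^ 2
      + (Set.Ici ((3 - t) / a)).indicator
          (fun u ↦ a * u / t - (a * u / t) ^ 2 / 2 + (a * u / t) ^ 3 / 3) u / Real.cosh u ^ 2 :=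
    q1.add q4
  have q14c : Integrable fun u : ℝ ↦ (Y + Z / Real.log t) * (max (-(a * u / t) - 2) 0 / Real.cosh u ^ 2
      + (Set.Ici ((3 - t) / a)).indicator
          (fun u ↦ a * u / t - (a * u / t) ^ 2 / 2 + (a * u / t) ^ 3 / 3) u / Real.cosh u ^ 2) :=
    q14.const_mul _
  have q03 : Integrable fun u : ℝ ↦
      (Real.log X + Y * Real.log t + Z * Real.log (Real.log t)) / Real.cosh u ^ 2
      + (Set.Ioo ((-t - 1) / a) ((-t + 1) / a)).indicator (fun _ ↦ L) u
          / Real.cosh u ^ 2 := q0.add q3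
  have hIM : Integrable fun u : ℝ ↦
      ((Real.log X + Y * Real.log t + Z * Real.log (Real.log t)) / Real.cosh u ^ 2
        + (Set.Ioo ((-t - 1) / a) ((-t + 1) / a)).indicator (fun _ ↦ L) u
            / Real.cosh u ^ 2)
      + (Y + Z / Real.log t) * (max (-(a * u / t) - 2) 0 / Real.cosh u ^ 2
        + (Set.Ici ((3 - t) / a)).indicator
            (fun u ↦ a * u / t - (a * u / t) ^ 2 / 2 + (a * u / t) ^ 3 / 3) u / Real.cosh u ^ 2) :=
    q03.add q14c
  -- Step 3: the integral of the majorant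
  have s1 := integral_add q03 q14c
  have s2 := integral_add q0 q3
  have s3 : ∫ u : ℝ, (Y + Z / Real.log t) * (max (-(a * u / t) - 2) 0 / Real.cosh u ^ 2
      + (Set.Ici ((3 - t) / a)).indicator
          (fun u ↦ a * u / t - (a * u / t) ^ 2 / 2 + (a * u / t) ^ 3 / 3) u / Real.cosh u ^ 2)
      = (Y + Z / Real.log t) * ∫ u : ℝ, (max (-(a * u / t) - 2) 0 / Real.cosh u ^ 2
      + (Set.Ici ((3 - t) / a)).indicator
          (fun u ↦ a * u / t - (a * u / t) ^ 2 / 2 + (a * u / t) ^ 3 / 3) u / Real.cosh u ^ 2) :=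
    integral_const_mul _ _
  have s4 := integral_add q1 q4
  have e0 : ∫ u : ℝ, (Real.log X + Y * Real.log t + Z * Real.log (Real.log t)) / Real.cosh u ^ 2
      = 2 * (Real.log X + Y * Real.log t + Z * Real.log (Real.log t)) := by
    have e : (fun u : ℝ ↦ (Real.log X + Y * Real.log t + Z * Real.log (Real.log t)) / Real.cosh u ^ 2)
        = fun u ↦ (Real.log X + Y * Real.log t + Z * Real.log (Real.log t)) * (1 / Real.cosh u ^ 2) :=
      funext fun u ↦ by ring
    rw [e, integral_const_mul, integral_inv_cosh_sq]
    ring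
  have B3 := integral_near_le_of_const hL0 ha ht3
  have B1 := integral_lower_excess_le ha ht0
  have B4 := integral_upper_le ha ha2 ht
  have N3 := hLnum
  have N1 := numerics_lower ha ha2 ht
  have N4 := numerics_upper ha ha2 ht
  have hq : 0 ≤ a ^ 2 / (12 * t ^ 2) := by positivity
  have h14 : (∫ u : ℝ, max (-(a * u / t) - 2) 0 / Real.cosh u ^ 2)
      + (∫ u : ℝ, (Set.Ici ((3 - t) / a)).indicator
          (fun u ↦ a * u / t - (a * u / t) ^ 2 / 2 + (a * u / t) ^ 3 / 3) u / Real.cosh u ^ 2)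
        ≤ -(a ^ 2 / (12 * t ^ 2)) := by
    have e : a ^ 2 / (4 * t ^ 2) = 3 * (a ^ 2 / (12 * t ^ 2)) := by ring
    linarith
  have h14c := mul_le_mul_of_nonneg_left h14 hc0.le
  have h3c : (∫ u : ℝ, (Set.Ioo ((-t - 1) / a) ((-t + 1) / a)).indicator
      (fun _ ↦ L) u / Real.cosh u ^ 2)
        ≤ (Y + Z / Real.log t) * (a ^ 2 / (12 * t ^ 2)) :=
    B3.trans (N3.trans (mul_le_mul_of_nonneg_right hcℓ hq))
  have hIMle : ∫ u : ℝ, ((Real.log X + Y * Real.log t + Z * Real.log (Real.log t)) / Real.cosh u ^ 2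
        + (Set.Ioo ((-t - 1) / a) ((-t + 1) / a)).indicator (fun _ ↦ L) u
            / Real.cosh u ^ 2)
      + (Y + Z / Real.log t) * (max (-(a * u / t) - 2) 0 / Real.cosh u ^ 2
        + (Set.Ici ((3 - t) / a)).indicator
            (fun u ↦ a * u / t - (a * u / t) ^ 2 / 2 + (a * u / t) ^ 3 / 3) u / Real.cosh u ^ 2)
      ≤ 2 * (Real.log X + Y * Real.log t + Z * Real.log (Real.log t)) := by
    rw [s1, s2, s3, s4, e0]
    linarith [h14c, h3c]
  -- Step 4: conclusion
  by_cases hint : Integrable fun u : ℝ ↦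
      Real.log ‖riemannZeta ((σ : ℂ) + ((t + u * a : ℝ) : ℂ) * I)‖ / Real.cosh u ^ 2
  · refine le_trans (integral_mono hint hIM fun u ↦ ?_) hIMle
    have hc2 : 0 < Real.cosh u ^ 2 := by positivity
    have h := div_le_div_of_nonneg_right (hLM u) hc2.le
    refine h.trans (le_of_eq ?_)
    ring
  · rw [integral_undef hint]
    linarith


open FordL34 Literature.Analysis.SpecialFunctions in
/-- **Ford 2002, Lemma 3.4 = Mossinghoff–Trudgian–Yang, Lemma 4.3.** Fix `σ ∈ [1/2, 1)` and
suppose that for all `T ≥ 3`, `|ζ(σ + iy)| ≤ X T^Y (log T)^Z` whenever `1 ≤ |y| ≤ T`, where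
`X ≥ 1`, `Y, Z ≥ 0`, `Y + Z ≥ 1/10`. If `0 < a ≤ 1/2`, `t ≥ 100` and `1/2 ≤ σ ≤ 1 − 1/t`, then
`∫_{-∞}^{∞} log|ζ(σ + it + iau)|/cosh²u du ≤ 2(log X + Y log t + Z log log t)`.
(The source asks `X, Y, Z > 0`; `1 ≤ X` is implicit in its proof — see the module docstring —
and positivity of `Y`, `Z` separately is not needed.) [cite: Ford2002Millennium, Lemma 3.4]
[cite: MossinghoffTrudgianYangRNT2024, Lemma 4.3] -/
theorem integral_log_norm_zeta_div_cosh_sq_le {σ X Y Z a t : ℝ} (hσ : 1 / 2 ≤ σ)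
    (hσt : σ ≤ 1 - 1 / t) (hX : 1 ≤ X) (hY : 0 ≤ Y) (hZ : 0 ≤ Z) (hYZ : 1 / 10 ≤ Y + Z)
    (hyp : ∀ T : ℝ, 3 ≤ T → ∀ y : ℝ, 1 ≤ |y| → |y| ≤ T →
      ‖riemannZeta (σ + y * I)‖ ≤ X * T ^ Y * Real.log T ^ Z)
    (ha : 0 < a) (ha2 : a ≤ 1 / 2) (ht : 100 ≤ t) :
    ∫ u : ℝ, Real.log ‖riemannZeta ((σ : ℂ) + ((t + u * a : ℝ) : ℂ) * I)‖ / Real.cosh u ^ 2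
      ≤ 2 * (Real.log X + Y * Real.log t + Z * Real.log (Real.log t)) := by
  have ht3 : 3 ≤ t := by linarith
  exact integral_log_norm_zeta_div_cosh_sq_le_of_near hX hY hZ hYZ hyp ha ha2 ht
    (fun y hy ↦ log_norm_zeta_le_near hσ ht3 hσt hy) (Real.log_nonneg (by linarith))
    (numerics_near ha ha2 ht)

open FordL34 Literature.Analysis.SpecialFunctions in
/-- **Ford's Lemma 3.4 on lines close to the pole** (`1 − 1/t < σ < 1` allowed): the conclusion of
`integral_log_norm_zeta_div_cosh_sq_le` holds for `1/2 ≤ σ < 1` as soon as `1 − σ ≥ e^{−t/a}`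
(then `log|ζ(σ + iy)| ≤ log(1/(1−σ) + 4) ≤ t/a + 2` on `|y| < 1`, and the window still contributes
less than the slack `a²/(120t² log t)`, `numerics_near'`). For `a = 2η/π`, `σ = 1 − η` the extra
hypothesis is void (`η ≥ e^{−πt/2η}`), which is what Ford's Lemma 4.1 needs for every `η > 0`.
[cite: Ford2002Millennium, Lemma 3.4 (proof)] -/
theorem integral_log_norm_zeta_div_cosh_sq_le' {σ X Y Z a t : ℝ} (hσ : 1 / 2 ≤ σ) (hσ1 : σ < 1)
    (hX : 1 ≤ X) (hY : 0 ≤ Y) (hZ : 0 ≤ Z) (hYZ : 1 / 10 ≤ Y + Z)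
    (hyp : ∀ T : ℝ, 3 ≤ T → ∀ y : ℝ, 1 ≤ |y| → |y| ≤ T →
      ‖riemannZeta (σ + y * I)‖ ≤ X * T ^ Y * Real.log T ^ Z)
    (ha : 0 < a) (ha2 : a ≤ 1 / 2) (ht : 100 ≤ t) (hexp : Real.exp (-(t / a)) ≤ 1 - σ) :
    ∫ u : ℝ, Real.log ‖riemannZeta ((σ : ℂ) + ((t + u * a : ℝ) : ℂ) * I)‖ / Real.cosh u ^ 2
      ≤ 2 * (Real.log X + Y * Real.log t + Z * Real.log (Real.log t)) := by
  have hta : 0 ≤ t / a := by positivity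
  refine integral_log_norm_zeta_div_cosh_sq_le_of_near hX hY hZ hYZ hyp ha ha2 ht
    (fun y hy ↦ (log_norm_zeta_le_near_of_lt_one hσ hσ1 hy).trans ?_) (by positivity)
    (numerics_near' ha ha2 ht)
  -- log(1/(1-σ) + 4) ≤ log(e^{t/a} + 4) ≤ t/a + 2
  have h1 : 1 / (1 - σ) ≤ Real.exp (t / a) := by
    rw [div_le_iff₀ (by linarith), ← div_le_iff₀' (Real.exp_pos _), div_eq_mul_inv, one_mul,
      ← Real.exp_neg]
    exact hexp
  have h2 : Real.exp (t / a) + 4 ≤ Real.exp (t / a + 2) := by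
    rw [Real.exp_add]
    have he2 : (5 : ℝ) ≤ Real.exp 2 := by
      have := Real.add_one_le_exp (2 : ℝ)
      have h := Real.exp_one_gt_d9
      have : Real.exp 2 = Real.exp 1 * Real.exp 1 := by rw [← Real.exp_add]; norm_num
      nlinarith
    nlinarith [Real.exp_pos (t / a), Real.one_le_exp hta]
  calc Real.log (1 / (1 - σ) + 4) ≤ Real.log (Real.exp (t / a + 2)) :=
        Real.log_le_log (by have h1σ : (0 : ℝ) < 1 - σ := by linarith
                            positivity)
          (by linarith)
    _ = t / a + 2 := Real.log_exp _

open FordL34 in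
/-- Ford's Lemma 3.4 in the notation of `VinogradovKorobovZeroDetector.lean`, on lines close to the
pole: `fordLogZetaIntegral σ t a ≤ 2(log X + Y log t + Z log log t)` for `1/2 ≤ σ < 1` with
`1 − σ ≥ e^{−t/a}` (see `integral_log_norm_zeta_div_cosh_sq_le'`). [cite: Ford2002Millennium, Lemma 3.4] -/
theorem fordLogZetaIntegral_le_of_zeta_bound' {σ X Y Z a t : ℝ} (hσ : 1 / 2 ≤ σ) (hσ1 : σ < 1)
    (hX : 1 ≤ X) (hY : 0 ≤ Y) (hZ : 0 ≤ Z) (hYZ : 1 / 10 ≤ Y + Z)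
    (hyp : ∀ T : ℝ, 3 ≤ T → ∀ y : ℝ, 1 ≤ |y| → |y| ≤ T →
      ‖riemannZeta (σ + y * I)‖ ≤ X * T ^ Y * Real.log T ^ Z)
    (ha : 0 < a) (ha2 : a ≤ 1 / 2) (ht : 100 ≤ t) (hexp : Real.exp (-(t / a)) ≤ 1 - σ) :
    fordLogZetaIntegral σ t a ≤ 2 * (Real.log X + Y * Real.log t + Z * Real.log (Real.log t)) := by
  rw [fordLogZetaIntegral]
  exact integral_log_norm_zeta_div_cosh_sq_le' hσ hσ1 hX hY hZ hYZ hyp ha ha2 ht hexp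

open FordL34 in
/-- Ford's Lemma 3.4 in the notation of `VinogradovKorobovZeroDetector.lean`:
`fordLogZetaIntegral σ t a ≤ 2(log X + Y log t + Z log log t)` under the hypotheses of
`integral_log_norm_zeta_div_cosh_sq_le`. [cite: Ford2002Millennium, Lemma 3.4] -/
theorem fordLogZetaIntegral_le_of_zeta_bound {σ X Y Z a t : ℝ} (hσ : 1 / 2 ≤ σ)
    (hσt : σ ≤ 1 - 1 / t) (hX : 1 ≤ X) (hY : 0 ≤ Y) (hZ : 0 ≤ Z) (hYZ : 1 / 10 ≤ Y + Z)
    (hyp : ∀ T : ℝ, 3 ≤ T → ∀ y : ℝ, 1 ≤ |y| → |y| ≤ T →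
      ‖riemannZeta (σ + y * I)‖ ≤ X * T ^ Y * Real.log T ^ Z)
    (ha : 0 < a) (ha2 : a ≤ 1 / 2) (ht : 100 ≤ t) :
    fordLogZetaIntegral σ t a ≤ 2 * (Real.log X + Y * Real.log t + Z * Real.log (Real.log t)) := by
  unfold fordLogZetaIntegral
  exact integral_log_norm_zeta_div_cosh_sq_le hσ hσt hX hY hZ hYZ hyp ha ha2 ht

/-- **Lemma 4.3 of Mossinghoff–Trudgian–Yang** (the form with the factor `1/2`):
`(1/2) ∫ log|ζ(σ + it + iau)|/cosh²u du ≤ log X + Y log t + Z log log t`.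
[cite: MossinghoffTrudgianYangRNT2024, Lemma 4.3] -/
theorem half_fordLogZetaIntegral_le_of_zeta_bound {σ X Y Z a t : ℝ} (hσ : 1 / 2 ≤ σ)
    (hσt : σ ≤ 1 - 1 / t) (hX : 1 ≤ X) (hY : 0 ≤ Y) (hZ : 0 ≤ Z) (hYZ : 1 / 10 ≤ Y + Z)
    (hyp : ∀ T : ℝ, 3 ≤ T → ∀ y : ℝ, 1 ≤ |y| → |y| ≤ T →
      ‖riemannZeta (σ + y * I)‖ ≤ X * T ^ Y * Real.log T ^ Z)
    (ha : 0 < a) (ha2 : a ≤ 1 / 2) (ht : 100 ≤ t) :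
    1 / 2 * fordLogZetaIntegral σ t a ≤ Real.log X + Y * Real.log t + Z * Real.log (Real.log t) := by
  have h := fordLogZetaIntegral_le_of_zeta_bound hσ hσt hX hY hZ hYZ hyp ha ha2 ht
  linarith

/-! ## Supplying the hypothesis from a Richert-type bound -/

open FordL34 in
/-- `|ζ(σ + iy)| ≤ 6` for `1/2 ≤ σ ≤ 1`, `1 ≤ |y| ≤ 3` (from (4.11.2) at `N = 1`:
`|ζ(s) − 1 + 1/(1−s)| ≤ 1/2 + |s|/(2σ)`, `|s| ≤ √10`, `|1 − s| ≥ |y| ≥ 1`). [folklore] -/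
theorem norm_zeta_le_six {σ y : ℝ} (hσ : 1 / 2 ≤ σ) (hσ1 : σ ≤ 1) (hy1 : 1 ≤ |y|)
    (hy3 : |y| ≤ 3) : ‖riemannZeta (σ + y * I)‖ ≤ 6 := by
  set s : ℂ := σ + y * I with hs
  have hsre : s.re = σ := by simp [hs]
  have hsim : s.im = y := by simp [hs]
  have hs1 : s ≠ 1 := by
    intro h; have := congrArg Complex.im h
    rw [hsim, Complex.one_im] at this
    rw [this, abs_zero] at hy1; linarith
  have hAFE := AFE.norm_zeta_sub_sum_add_le (s := s) (by rw [hsre]; linarith) hs1 (N := 1) le_rfl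
  simp only [Finset.Icc_self, Finset.sum_singleton, Nat.cast_one, Complex.one_cpow, hsre] at hAFE
  rw [Real.one_rpow, one_mul] at hAFE
  -- `‖s‖ ≤ 3.2`
  have hns : ‖s‖ ≤ 3.2 := by
    have hsq : ‖s‖ ^ 2 ≤ 10 := by
      rw [← Complex.normSq_eq_norm_sq, Complex.normSq_apply, hsre, hsim]
      have hy : y * y ≤ 9 := by nlinarith [abs_le.1 hy3, sq_abs y]
      nlinarith
    nlinarith [norm_nonneg s]
  -- `‖1/(1 - s)‖ ≤ 1`
  have h1s : 1 ≤ ‖1 - s‖ := by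
    have h := Complex.abs_im_le_norm (1 - s)
    simp only [Complex.sub_im, Complex.one_im, hsim, zero_sub, abs_neg] at h
    linarith
  have hinv : ‖(1 : ℂ) / (1 - s)‖ ≤ 1 := by
    rw [norm_div, norm_one, div_le_one (by linarith)]; exact h1s
  have htri : ‖riemannZeta s‖ ≤ ‖riemannZeta s - 1 + 1 / (1 - s)‖ + ‖(1 : ℂ)‖ + ‖(1 : ℂ) / (1 - s)‖ := by
    have e : riemannZeta s = (riemannZeta s - 1 + 1 / (1 - s)) + 1 - 1 / (1 - s) := by ring
    calc ‖riemannZeta s‖ = ‖(riemannZeta s - 1 + 1 / (1 - s)) + 1 - 1 / (1 - s)‖ := by rw [← e]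
      _ ≤ ‖(riemannZeta s - 1 + 1 / (1 - s)) + 1‖ + ‖(1 : ℂ) / (1 - s)‖ := norm_sub_le _ _
      _ ≤ _ := by gcongr; exact norm_add_le _ _
  have hb : ‖s‖ / (2 * σ) ≤ 3.2 := by
    rw [div_le_iff₀ (by linarith)]; nlinarith [norm_nonneg s]
  rw [norm_one] at htri
  linarith

open FordL34 in
/-- **From a Richert-type bound to the hypothesis of Lemma 3.4.** If `RichertBound A B` holds
(`|ζ(σ + it)| ≤ A|t|^{B(1−σ)^{3/2}} log^{2/3}|t|` for `|t| ≥ 3`, `1/2 ≤ σ ≤ 1`) with `A ≥ 6`,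
`B ≥ 0`, then for every `σ ∈ [1/2, 1]` and `T ≥ 3`: `|ζ(σ + iy)| ≤ A T^{B(1−σ)^{3/2}} (log T)^{2/3}`
for `1 ≤ |y| ≤ T` (the range `1 ≤ |y| < 3`, not covered by the Richert bound, by
`norm_zeta_le_six`). This is the input "`X = A`, `Y = B(1 − σ + η)^{3/2}`, `Z = 2/3`" of Ford's
Lemma 4.1 / Mossinghoff–Trudgian–Yang Lemma 4.2 on the line `Re s = 1 − η`.
[cite: Ford2002Millennium, Lemma 4.1 (proof)] -/
theorem zeta_bound_of_richertBound {A B σ : ℝ} (hA : 6 ≤ A) (hB : 0 ≤ B) (hR : RichertBound A B)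
    (hσ : 1 / 2 ≤ σ) (hσ1 : σ ≤ 1) :
    ∀ T : ℝ, 3 ≤ T → ∀ y : ℝ, 1 ≤ |y| → |y| ≤ T →
      ‖riemannZeta (σ + y * I)‖ ≤ A * T ^ (B * (1 - σ) ^ (3 / 2 : ℝ)) * Real.log T ^ (2 / 3 : ℝ) := by
  intro T hT y hy1 hyT
  have hA0 : 0 ≤ A := by linarith
  have he : 0 ≤ B * (1 - σ) ^ (3 / 2 : ℝ) := mul_nonneg hB (Real.rpow_nonneg (by linarith) _)
  rcases le_or_gt |y| 3 with h3 | h3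
  · have h6 := norm_zeta_le_six hσ hσ1 hy1 h3
    have h1 := one_le_bound (X := 1) le_rfl hT he (by norm_num : (0:ℝ) ≤ 2 / 3)
    rw [one_mul] at h1
    calc ‖riemannZeta (σ + y * I)‖ ≤ 6 := h6
      _ ≤ A * 1 := by linarith
      _ ≤ A * (T ^ (B * (1 - σ) ^ (3 / 2 : ℝ)) * Real.log T ^ (2 / 3 : ℝ)) :=
          mul_le_mul_of_nonneg_left h1 hA0
      _ = _ := by ring
  · have hRy := hR σ y h3.le hσ hσ1
    have hy0 : 0 < |y| := by linarith
    have hlogy : 0 ≤ Real.log |y| := Real.log_nonneg (by linarith)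
    have h1 : |y| ^ (B * (1 - σ) ^ (3 / 2 : ℝ)) ≤ T ^ (B * (1 - σ) ^ (3 / 2 : ℝ)) :=
      Real.rpow_le_rpow (abs_nonneg y) hyT he
    have h2 : Real.log |y| ^ (2 / 3 : ℝ) ≤ Real.log T ^ (2 / 3 : ℝ) :=
      Real.rpow_le_rpow hlogy (Real.log_le_log hy0 hyT) (by norm_num)
    calc ‖riemannZeta (σ + y * I)‖ ≤ A * |y| ^ (B * (1 - σ) ^ (3 / 2 : ℝ)) * Real.log |y| ^ (2 / 3 : ℝ) := hRy
      _ ≤ A * T ^ (B * (1 - σ) ^ (3 / 2 : ℝ)) * Real.log T ^ (2 / 3 : ℝ) := by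
          gcongr

end Literature.NumberTheory.LFunctions
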